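import Literature.MathematicalPhysics.QuantumFieldTheory.Balaban1983to89.B10Eq17LocalSolution
import Literature.MathematicalPhysics.QuantumFieldTheory.Balaban1983to89.B11Eq26FirstVariation
import Literature.MathematicalPhysics.QuantumFieldTheory.Balaban1983to89.B11Eq177FirstOrder
import Literature.MathematicalPhysics.QuantumFieldTheory.Balaban1983to89.B10SectCExpansion
import Literature.MathematicalPhysics.QuantumFieldTheory.Balaban1983to89.B11Eq26ExpansionZpow

/-!
# `Balaban1983to89.B10Eq19LinearTerm` — T. Bałaban, *Ultraviolet stability of three-dimensional lattice pure gauge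
# field theories*, Commun. Math. Phys. **102** (1985) 255–275 [Balaban1985UV3], p. 260 (before (19)): «The function in
# the exponential, considered on the space of configurations A restricted by the δ-functions and the characteristic
# functions χ, has a minimum at A = 0. This implies that a linear term in its expansion vanishes.» — PROVED (theorems
# only) from the printed inputs (12), (17) and the standing differentiability, by Fermat's lemma along the constraint
# subspace

statement-level skeleton of published theorems with citation tags; proofs where landed; nothing here is a claim
about the Yang–Mills mass gap

PDF held: `paper:balaban1985-cmp102-uv-stability-3d` (journal page = PDF page + 254); p. 260 [PDF 6] read as image from
the x2 render `pub-balaban/b2b-balaban-ref1/pages/1985-cmp102-uv-stability-3d/1985-cmp102-uv-stability-3d-p006-x2.png`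
(this seat, 2026-08-21), pp. 258–259 ((12), (17)) and p. 269 ((53)) from the held text layer.

WHAT IS REPRODUCED.  Mega-formalization `lit-balaban` (HOME `run/shared/lean/pub/lit-balaban/`), unit `lit-balaban-r07`
gen 14 (B10 fold owner; TAKING line HOME/STATUS.md 2026-08-21T22:20:13Z).  SKELETON: the proof-narrative display **E19**
of `lit-balaban-r07/ROWS-B10.md` §2 («… minimum at A = 0 ⇒ no linear term», recorded there as «not separately typed»)
— the sentence that turns the expansion (26) of [7] into the printed (19) «A(exp i(A − D̃(A))U₁) = A(U₁) − ⟨D̃(A), J⟩ +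
½⟨A − D̃(A), Δ(U₁)(A − D̃(A))⟩ + V₀(A − D̃(A))» WITHOUT a term ⟨A, J⟩; the same mechanism at step k (p. 269, (53)) is
the FIRST of the located «orthogonality relations» typed as the hypothesis `B10SectCExpansion.Orthogonality53` (row
B10.Eq53; gen 1) — see HONEST SCOPE (iii).

THE PRINTED TEXT (p. 260, verbatim, render p006-x2).  *"Thus we have (18) … where χ = ∏_{b∈Ω₁} χ({|A(b)| < g₀p²(g₀)}),
g₀ sufficiently small, and |Ω₁*| denotes the number of bonds belonging to Ω₁ minus the number of bonds in Ω₁^{(1)} and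
minus the number of bonds in the axial gauge fixing set. The function in the exponential, considered on the space of
configurations A restricted by the δ-functions and the characteristic functions χ, has a minimum at A = 0. This
implies that a linear term in its expansion vanishes. This expansion, with a special emphasis on linear and quadratic
terms, was described in [7], Eq. (26). The linear term is determined by the function J = D*_{U₁} Im U₁, and the
quadratic term is determined by an operator of the form D*_{U₁}D_{U₁} + (a small perturbation)"* — the function in the
exponential of (18) being `A ↦ A(exp i(A − D̃(A))U₁)`, the δ-functions `δ(QA)δ_{Ax}(A)` (a LINEAR subspace
`S = ker Q ∩ Ax` of the bond fields), `U₁` the minimal configuration of (12) (p. 259: «there exists the exactly one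
critical configuration U₁ in a space of regular configurations satisfying the conditions in (12)»; a minimum of
`U ↦ A(U)` under `Ū = V on Ω₁^{(1)}, U axial on Ω₁`), and (17) p. 259–260 the equation making `exp(i(A − D̃(A)))U₁`
satisfy the same average constraint («Q(A − D̃(A, c), c) = (QA)(c)», so `QA = 0` ⇒ averages unchanged) with «a Taylor
expansion beginning with second order terms» for `D̃`.

THE ARGUMENT FORMALISED ([folklore]: Fermat's lemma along a line, exactly as in the B11 block's
`B11Eq127EulerLagrange.eq127_of_isMinOn` for (127)).  Write `f(A) := A(exp i(A − D̃(A))U₁)`.  (a) By (17) + the axial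
gauge, for `A ∈ S` small the configuration `exp(i(A − D̃(A)))U₁` lies in the constrained class of (12), and by (12) `U₁
= (the configuration at A = 0)` minimises the action there; hence `f(0) ≤ f(A)` for `A ∈ S`, `|A| < r` — «has a minimum
at A = 0».  (b) `f` is differentiable at `0` (print: analytic) with derivative `ℓ`; for `v ∈ S` the line `t ↦ f(tv)`
has a local minimum at `t = 0` and derivative `ℓ(v)` there, so `ℓ(v) = 0` (Fermat) — «a linear term in its expansion
vanishes» ON THE CONSTRAINT SPACE.  (c) With (26) of [7], `f(A) = A(U₁) + ⟨A − D̃(A), J⟩ + (terms with vanishing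
derivative at 0)`, and with `D̃′(0) = 0` ((17): Taylor expansion from second order — the tree's `Eq17Local` records
`HasFDerivAt D̃ 0 0`), the derivative is `ℓ = ⟨·, J⟩`; so `⟨v, J⟩ = 0` for every `v ∈ S`, and (19) keeps only
`−⟨D̃(A), J⟩` from the linear term of (26), as printed.

WHAT THIS FILE PROVES (theorems only; kernel, 0 sorry, standard axioms; no definition, no new named fact):
* §1 FERMAT ALONG A SUBSPACE (real normed space `E`, submodule `S`): `hasDerivAt_comp_line` (the line `t ↦ f(tv)` has
  derivative `f′(0)v`), `isLocalMin_line_of_minOn` (minimum on `S ∩ {|A| < r}` ⇒ local minimum along every line in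
  `S`), **`fderiv_apply_eq_zero_of_minOn_subspace`** (`⇒ f′(0)v = 0` for all `v ∈ S`), and the `IsMinOn` phrasing
  `fderiv_apply_eq_zero_of_isMinOn`.
* §2 THE p. 260 SENTENCE on abstract B10 data (configurations `Cfg`, action `act`, the constrained class `Constr` of
  (12), the chart `Φ : A ↦ exp(i(A − D̃(A)))U₁` with `Φ 0 = U₁`): **`linearTerm_vanishes`** — (12) `∀ U, Constr U →
  act (Φ 0) ≤ act U` + (17)/(9) `∀ A ∈ S, |A| < r → Constr (Φ A)` + `HasFDerivAt (act ∘ Φ) ℓ 0` ⇒ `ℓ v = 0` on `S`;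
  `minimum_at_zero` (the first half of the sentence: `act (Φ 0) ≤ act (Φ A)` on `S` near `0`).
* §3 THE (19) FORM with (26) of [7]: **`inner_J_eq_zero_of_expansion26`** — if near `0` the function in the exponential
  is `f(A) = f(0) + φ(A − D̃ A) + q(A)` with `φ` continuous linear («⟨·, J⟩»), `HasFDerivAt D̃ 0 0` and `HasFDerivAt q
  0 0` (quadratic and higher terms), then `HasFDerivAt f φ 0` (`hasFDerivAt_of_expansion26`) and, under the minimum on
  `S`, `φ v = 0` for all `v ∈ S` («J ⟂ S»); `linear_term_absent_19` (consequently on `S` the expansion reads `f(A) =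
  f(0) − φ(D̃ A) + q(A)`, the shape of (19)).
* §4 KNIT WITH THE TREE'S (17): **`fderiv_hOp_Dt_zero`** / `inner_J_eq_zero_of_eq17Local` — the hypothesis `D̃′(0) =
  0` of §3 supplied BY NAME from `B10Eq17LocalSolution.Eq17Local ℝ b₀ h C̃ r δ Dt` (its clause «Taylor expansion
  beginning with second order terms») for the support operator `A ↦ hD̃(A)` of p. 260 (`hOpLin`, sup-norm bound
  `norm_hOpLin_le`), on the bond-field space `β → X`.
* §5 (v1.1) (19) END TO END ON THE CARRIER OF [7] (26) — the hypotheses `h26`/`hq` of §3 SUPPLIED BY NAME from the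
  B11 block's `B11Eq26FirstVariation.expansion26_real` (seat r08, p308406: `J` is the first variation of the Wilson
  action at the background, the rest of (26) is of second order at `0`): **`re_inner_J_eq_zero_b11`** (`Re⟨v, J⟩ = 0`
  on the constraint space, any background), **`inner_J_eq_zero_b11`** (`⟨v, J⟩ = 0` on a constraint space of Hermitian
  fields over a unitary background, via r08's `bondPair_J_eq_zero_on` = (27)–(28) «from hermiticity»),
  **`expansion19_b11`** (the printed shape of (19): `Re A(exp iη(A − D̃A)U₁) = Re A(U₁) − Re⟨D̃A, J⟩ + q(A)` on `S`, `q′(0)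
  = 0`), and **`inner_J_eq_zero_b11_of_eq17Local`** (the same with `D̃` = the tree's (17) solution `Eq17Local ℝ …`
  placed by the support operator `h` and read in the carrier's coordinates through continuous linear identifications
  `e`, `e′` of the two bond-field spaces) — so that the ONLY remaining hypothesis of the p. 260 sentence is its first
  half, the minimality (12) of `U₁` along the chart (`hmin`).
* §6 (v1.2) STEP k (p. 268 «We take the minimal configuration V^{(k)} of the functional A^η(U_k) …», (52)–(53)
  p. 268–269): the same Fermat argument for the step-k «function in the exponential» `f(A) = 𝔉(𝒜₁(A − D̃A) + H₁(A −
  D̃A))` — `𝔉` = the functional (74) of [7] at the base point `U₀ = U_{k+1}` (derivative `⟨·, J⟩` at `0` by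
  (81)/(84)), `𝓗(B) = 𝒜₁(B) + H₁B − HD(𝒜₁(B) + H₁B)` the representation (174) with `𝒜₁` of SECOND order ((176)) —:
  **`inner_H1_J_eq_zero_stepk`** (abstract second-order form: `φ(H₁v) = 0` on the constraint space `S`),
  `expansion53_linear_stepk` (the third member of (53) keeps only `−⟨H₁D̃(A), J⟩` from the linear term),
  **`orthogonality53_inner_H1_J`** (the conjunct `⟪H₁A, J⟫ = 0` of row B10.Eq53's `B10SectCExpansion.Orthogonality53`
  DISCHARGED in its own letters modulo the minimality of `V^{(k)}`), **`inner_H1_J_eq_zero_b11_scheme`** /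
  `expansion53_linear_b11_scheme` (END TO END in the Sect. E–G scheme of [7]: (176)–(177) supplied BY NAME from the
  B11 block's `B11Eq177FirstOrder.expansion_firstOrder_comp`, seat r08 p311323) and `inner_H1_J_eq_zero_functional74`
  (`𝔉′(0) = ⟨·, J⟩` supplied BY NAME from r08's `hasFDerivAt_functional74_zero` for the functional (74) with `HD`,
  `V₀` of second order and `Δ_π` bounded).
* §7 (v1.3) THE «ORTHOGONALITY RELATIONS» OF (53) DERIVED (p. 269 «We have used also orthogonality relations following from the
  definitions of operations and configurations used above»): the located reading `B10SectCExpansion.Orthogonality53` (row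
  B10.Eq53, until now a HYPOTHESIS of `expansion53_of_line2`) becomes a THEOREM from print's cited inputs and the minimality
  of `V^{(k)}` — **`orthogonality53_of_minimality`**: (i) `⟨H₁A, J⟩ = 0` = §6; (ii) `⟨𝓗₁, J⟩ = 0` from `𝓗₁(A) = 𝒜₁(A − D̃A) ∈ T
  = ker Q ∩ ker RD*` ([7] p. 294 «Q𝔊 = 0, RD*𝔊 = 0»; in the Sect. E–G scheme a theorem BY NAME from
  `B11Prop6Scheme.solution_mem_submodule`: `calA1_mem_of_range_le`, `inner_calA1_J_eq_zero_b11_scheme`) and (170) `J ⟂ T`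
  BY NAME from r08's `B11Eq177FirstOrder.inner_J_eq_zero_of_isLocalMinOn` (the functional (81) minimal at `A′ = 0` on `T`);
  (iii) the cross term `⟨H₁(A − D̃A), Δ₁𝓗₁⟩ = 0` from [7] p. 293 «⟨δA′, Δ₁H₁B⟩ = 0 on T» (r08's
  `B11Eq101Translation.inner_delta1_H1_eq_zero`; a hypothesis in the (53) letters) and the symmetry of `Δ₁`; and since the
  second member of (53) IS the functional (81) of [7] at `A′ = H₁(A − D̃A) + 𝓗₁(A)` (`line2_53_of_functional81`,
  definitional), **`expansion53_of_minimality`**: the THIRD member of (53) (`Expansion53`) modulo located [7] statements and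
  the minimality only (via `expansion53_of_line2`, p238811).
* §8 (v1.4) THE SAME IN [7]'s OWN OPERATOR LETTERS — the two located hypotheses of §7 (`h𝒜T`, `h293`) DISCHARGED BY NAME from
  the B11 block (`B11Eq177FirstOrder` v1.3 §7, r08 p313597): `T = tangent83 Q R D*` ((83)/(109)); (170) via `eq170` from the
  minimality on `T`; `⟨𝓗₁, J⟩ = 0` via `inner_solution175_J_eq_zero` from the equation (175) `𝒜₁(B) + 𝔊w = 0` and p. 294
  «Q𝔊 = 0, RD*𝔊 = 0»; the cross term via `inner_hOp_delta1_eq_zero` from `H₁ = G₁Q*(QG₁Q*)⁻¹` ((45)/(129),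
  `B11Eq129Minimizer.hOp`), `Δ_{1,a}G₁ = 1`, `⟨x, Q*y⟩ = ⟨Qx, y⟩`, `RD*H₁ = 0` (the p. 293 identity =
  `B11Eq101Translation.inner_delta1_H1_eq_zero`): **`orthogonality53_of_minimality_b11ops`**,
  **`expansion53_of_minimality_b11ops`** — remaining hypotheses = [7]'s defining equations/identities in B11's letters and
  the minimality of `V^{(k)}` along the two charts.
* §9 (v1.5) §5 AT EVERY DIMENSION, IN PARTICULAR `d = 3` (the dimension of this paper; (5) p. 256 «A^η(U_k(U)) =
  Σ_{p⊂T_η} η⁻¹[1 − Re tr U_k(U)(∂p)]»): the four theorems of §5 with the (26) inputs supplied BY NAME from the B11 block's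
  `B11Eq26ExpansionZpow.expansion26_real_zpow` (seat r08, p343405) on the integer-power action `B9Eq31ActionZpow.actionZ`
  (seat r06, p342252; weight `(η:ℂ)^((d:ℤ)−4)`, `= η⁻¹` at `d = 3`) — **`re_inner_J_eq_zero_b11_zpow`**,
  **`expansion19_b11_zpow`**, **`inner_J_eq_zero_b11_zpow`**, **`inner_J_eq_zero_b11_of_eq17Local_zpow`** (every `d : ℕ`,
  no `4 ≦ d`); the `d = 3` instances **`inner_J_eq_zero_b11_three`** / `inner_J_eq_zero_b11_three_printed` (the latter with
  the η⁻¹-weighted plaquette sum of (5) displayed, `actionZ_three`); and `re_inner_J_eq_zero_b11_of_four_le` (for `4 ≦ d`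
  the §5 theorem is recovered from §9 by `actionZ_eq_action`).  This retires HONEST SCOPE (v) below.
HONEST SCOPE.  (i) The minimality (12) of `U₁`, the constraint preservation by the chart ((17) + axial gauge) and the
differentiability of the action along the chart are HYPOTHESES in their printed shape — rows B10.Eq12 (= [7] Thm 1,
statement row) and B10.Eq17 (proved in the local reading, `Eq17Local`); nothing of [7]'s construction is re-proved.
(ii) «restricted by … the characteristic functions χ»: the cut-off `|A(b)| < g₀p²(g₀)` only localises the statement to
a neighbourhood of `0`, which is how it enters (`|A| < r`).  (iii) Step k (p. 269): the same theorem applies verbatim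
to the chart `A ↦ U_k(exp i(A − D̃(A))V_k^{(k)})` and the minimality of `U_{k+1}`; it yields `ℓ|_S = 0` for the
derivative `ℓ` of the step-k function, which is the relation `⟨H₁A, J⟩ = 0` of `Orthogonality53` exactly when the
remaining first-order contributions of (53)'s second member vanish at first order — that identification ([7] Sect. G,
the structure of `𝓗₁`) was NOT formalised up to v1.1.  Since v1.2 (§6) it IS, by name from the B11 block's (176)–(177)
(`B11Eq177FirstOrder`): `𝒜₁′(0) = 0`, so the derivative of the step-k function is `⟨H₁·, J⟩` and the conjunct
`⟪H₁A, J⟫ = 0` of `Orthogonality53` is a THEOREM modulo the minimality of `V^{(k)}` (and, in the row's letters, the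
identification `actFl A = 𝔉(𝒜₁(A − D̃A) + H₁(A − D̃A))` of (52)/(174), a hypothesis `hact`); the other two located
relations (`⟨𝓗₁, J⟩ = 0` via `𝒜₁ ∈ ker Q ∩ ker RD*`, (170); the cross term `⟨H₁(A − D̃A), Δ₁𝓗₁⟩ = 0` via p. 293 of
[7]) remained hypotheses at v1.2.  Since v1.3 (§7) all three are DERIVED in the (53) letters from: the minimality of
`V^{(k)}` read along the two charts of [7] ((50)/(174) on `S`, (47)/(74) on `T` — Props. 2–3 of [7] identify both with
«U_{k+1} minimal»; hypotheses `hmin`, `hminT` in printed shape), `𝒜₁(B) ∈ T` ([7] p. 294; hypothesis `h𝒜T` in the (53)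
letters, theorem `calA1_mem_of_range_le` in the scheme), the p. 293 identity of [7] (hypothesis `h293`; r08's theorem in
B11's letters), `Δ₁` symmetric and continuous, `V′(0) = 0` ((80)), and the identification `actFl = (81) at H₁(A − D̃A) +
𝓗₁(A)` (`hact`, = print's «using … (26), (174), (74), (78)–(81) of [7]»).  Nothing of [7] is re-proved; in §7 the p. 293 /
p. 294 inputs are located hypotheses in the (53) letters; in §8 (v1.4) they are supplied BY NAME from B11's real-inner-product
theorems once the (53) letters are identified with [7]'s operators (`H₁ = G₁Q*(QG₁Q*)⁻¹`, `T = tangent83 Q R D*`, (175) with the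
letter `𝔊`) — the identifications and [7]'s structural identities (`Δ_{1,a}G₁ = 1`, `RD*H₁ = 0`, `Q𝔊 = 0`, `RD*𝔊 = 0`, the
equation (175)) being the hypotheses there, exactly as in r08's B11 files.  (iv) Real
scalars (the action is real); `E` any real normed space (print: 𝔤-valued bond fields on Ω₁ with the sup norm).  NOT
summit progress.  (v) §5 inherits the carrier hypotheses of `B11Eq26FirstVariation` — `η ≠ 0` and `4 ≦ d` (the
natural-number exponent `η^{d−4}` of [5] (3.12) as typed there) —: for B10 (d = 3, unit lattice η = 1 at the first
step) the printed weight `η^{d−4}` equals `1` and the conclusion `⟨v, J⟩ = 0` does not see `d`, but the theorem as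
typed is the `d ≧ 4` instance of the carrier; a `d`-free (3.12) carrier would remove the binder (B11/B9 owners' call).
Since v1.5 (§9) that carrier EXISTS (`B9Eq31ActionZpow.actionZ`, `B11Eq26ExpansionZpow`) and §9 states the four §5
theorems for every `d : ℕ`, in particular at `d = 3` with the printed weight `η⁻¹` of (5) p. 256: clause (v) is
retired for §9 (it still describes the v1.1 §5 theorems, kept unchanged for their consumers).
-/

noncomputable section

open Filter Topology Metric

namespace Literature.MathematicalPhysics.QuantumFieldTheory.Balaban1983to89.B10Eq19LinearTerm

/-! ## §1 Fermat's lemma along a linear subspace of constraints -/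

section Fermat

variable {E : Type*} [NormedAddCommGroup E] [NormedSpace ℝ E]

/-- the line `t ↦ f(t·v)` through `0` in direction `v` has derivative `f′(0)(v)` at `t = 0` (chain rule).
[cite: Balaban1985UV3, p.260 (before (19))] -/
theorem hasDerivAt_comp_line {f : E → ℝ} {f' : E →L[ℝ] ℝ} (hf : HasFDerivAt f f' 0) (v : E) :
    HasDerivAt (fun t : ℝ => f (t • v)) (f' v) 0 := by
  have hl : HasDerivAt (fun t : ℝ => t • v) v 0 := by
    simpa using (hasDerivAt_id (0 : ℝ)).smul_const v
  have hf0 : HasFDerivAt f f' ((fun t : ℝ => t • v) 0) := by simpa using hf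
  exact hf0.comp_hasDerivAt (0 : ℝ) hl

/-- «has a minimum at A = 0» on the constraint subspace near `0` ⇒ along every line in the subspace the function has a
local minimum at `t = 0`. [cite: Balaban1985UV3, p.260 (before (19))] -/
theorem isLocalMin_line_of_minOn (S : Submodule ℝ E) {f : E → ℝ} {r : ℝ} (hr : 0 < r)
    (hmin : ∀ A ∈ S, ‖A‖ < r → f 0 ≤ f A) {v : E} (hv : v ∈ S) :
    IsLocalMin (fun t : ℝ => f (t • v)) 0 := by
  have hρ : 0 < r / (‖v‖ + 1) := div_pos hr (by positivity)
  have hev : ∀ᶠ t : ℝ in 𝓝 0, ‖t‖ < r / (‖v‖ + 1) := by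
    have := Metric.ball_mem_nhds (0 : ℝ) hρ
    filter_upwards [this] with t ht
    simpa [Metric.mem_ball, dist_zero_right] using ht
  show ∀ᶠ t : ℝ in 𝓝 0, f ((0 : ℝ) • v) ≤ f (t • v)
  filter_upwards [hev] with t ht
  rw [zero_smul]
  apply hmin _ (S.smul_mem t hv)
  rw [norm_smul]
  have h1 : ‖t‖ * (‖v‖ + 1) < r := by
    have := (lt_div_iff₀ (by positivity : (0 : ℝ) < ‖v‖ + 1)).1 ht
    linarith
  nlinarith [norm_nonneg t, norm_nonneg v]

/-- **FERMAT ALONG THE CONSTRAINT SUBSPACE** («This implies that a linear term in its expansion vanishes»): if `f` is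
Fréchet-differentiable at `0` with derivative `f′` and `f(0) ≤ f(A)` for all `A` of a linear subspace `S` with
`|A| < r`, then `f′ v = 0` for every `v ∈ S` — the linear term of the expansion of `f` vanishes on `S`.
[cite: Balaban1985UV3, p.260 (before (19))] -/
theorem fderiv_apply_eq_zero_of_minOn_subspace (S : Submodule ℝ E) {f : E → ℝ} {f' : E →L[ℝ] ℝ}
    (hf : HasFDerivAt f f' 0) {r : ℝ} (hr : 0 < r) (hmin : ∀ A ∈ S, ‖A‖ < r → f 0 ≤ f A) :
    ∀ v ∈ S, f' v = 0 :=
  fun v hv => (isLocalMin_line_of_minOn S hr hmin hv).hasDerivAt_eq_zero (hasDerivAt_comp_line hf v)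

/-- the same with the minimum phrased as `IsMinOn f (S ∩ ball 0 r) 0`. [cite: Balaban1985UV3, p.260 (before (19))] -/
theorem fderiv_apply_eq_zero_of_isMinOn (S : Submodule ℝ E) {f : E → ℝ} {f' : E →L[ℝ] ℝ}
    (hf : HasFDerivAt f f' 0) {r : ℝ} (hr : 0 < r) (hmin : IsMinOn f ((S : Set E) ∩ Metric.ball 0 r) 0) :
    ∀ v ∈ S, f' v = 0 :=
  fderiv_apply_eq_zero_of_minOn_subspace S hf hr fun A hA hAr =>
    hmin ⟨hA, by simpa [Metric.mem_ball, dist_zero_right] using hAr⟩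

/-- the vanishing as an identity of the restricted functional: `f′ ∘ ι_S = 0`.
[cite: Balaban1985UV3, p.260 (before (19))] -/
theorem fderiv_comp_subtype_eq_zero (S : Submodule ℝ E) {f : E → ℝ} {f' : E →L[ℝ] ℝ}
    (hf : HasFDerivAt f f' 0) {r : ℝ} (hr : 0 < r) (hmin : ∀ A ∈ S, ‖A‖ < r → f 0 ≤ f A) :
    f'.comp S.subtypeL = 0 := by
  ext ⟨v, hv⟩
  simpa using fderiv_apply_eq_zero_of_minOn_subspace S hf hr hmin v hv

end Fermat

/-! ## §2 The p. 260 sentence on abstract B10 data: minimality (12) + the chart of (17) ⇒ no linear term on `S` -/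

section B10

variable {E Cfg : Type*} [NormedAddCommGroup E] [NormedSpace ℝ E]

/-- «The function in the exponential … has a minimum at A = 0»: with `Φ : A ↦ exp(i(A − D̃(A)))U₁` (so `Φ 0 = U₁`),
(12) `U₁` minimal in the constrained class `Constr` («Ū = V on Ω₁^{(1)}, U axial on Ω₁») and (17) + (9) keeping
`Φ A` in that class for `A ∈ S = ker Q ∩ Ax`, `|A| < r`: `A(U₁) = act (Φ 0) ≤ act (Φ A)`.
[cite: Balaban1985UV3, p.260 (before (19))] -/
theorem minimum_at_zero (S : Submodule ℝ E) (act : Cfg → ℝ) (Constr : Cfg → Prop) (Φ : E → Cfg)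
    (hU₁ : ∀ U, Constr U → act (Φ 0) ≤ act U) {r : ℝ} (hΦ : ∀ A ∈ S, ‖A‖ < r → Constr (Φ A)) :
    ∀ A ∈ S, ‖A‖ < r → (act ∘ Φ) 0 ≤ (act ∘ Φ) A :=
  fun A hA hAr => hU₁ _ (hΦ A hA hAr)

/-- **«THIS IMPLIES THAT A LINEAR TERM IN ITS EXPANSION VANISHES»** (p. 260): under (12) (minimality of `U₁ = Φ 0` in
the constrained class), (17) + (9) (the chart stays in the class on `S` near `0`) and differentiability of the action
along the chart at `0` with derivative `ℓ` (print: analytic), `ℓ v = 0` for every `v` in the constraint subspace `S`.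
[cite: Balaban1985UV3, p.260 (before (19))] -/
theorem linearTerm_vanishes (S : Submodule ℝ E) (act : Cfg → ℝ) (Constr : Cfg → Prop) (Φ : E → Cfg)
    (hU₁ : ∀ U, Constr U → act (Φ 0) ≤ act U) {r : ℝ} (hr : 0 < r) (hΦ : ∀ A ∈ S, ‖A‖ < r → Constr (Φ A))
    {ℓ : E →L[ℝ] ℝ} (hd : HasFDerivAt (act ∘ Φ) ℓ 0) :
    ∀ v ∈ S, ℓ v = 0 :=
  fderiv_apply_eq_zero_of_minOn_subspace S hd hr (minimum_at_zero S act Constr Φ hU₁ hΦ)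

end B10

/-! ## §3 The (19) form: with (26) of [7] the derivative is `⟨·, J⟩`, so `J ⟂ S` and (19) has no `⟨A, J⟩` -/

section Expansion26

variable {E : Type*} [NormedAddCommGroup E] [NormedSpace ℝ E]

/-- (26) of [7] organises the function in the exponential as `f(A) = f(0) + φ(A − D̃ A) + q(A)` with `φ = ⟨·, J⟩`
continuous linear («The linear term is determined by the function J = D*_{U₁} Im U₁»), `D̃` with vanishing derivative at
`0` ((17): «Taylor expansion beginning with second order terms») and `q` = the quadratic and higher terms (vanishing
derivative at `0`); then `f` has derivative `φ` at `0`. [cite: Balaban1985UV3, (19) p.261] -/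
theorem hasFDerivAt_of_expansion26 {f q : E → ℝ} {Dt : E → E} (φ : E →L[ℝ] ℝ)
    (h26 : ∀ᶠ A in 𝓝 (0 : E), f A = f 0 + φ (A - Dt A) + q A)
    (hDt : HasFDerivAt Dt (0 : E →L[ℝ] E) 0) (hq : HasFDerivAt q (0 : E →L[ℝ] ℝ) 0) :
    HasFDerivAt f φ 0 := by
  -- the model function `g A = f 0 + φ (A − Dt A) + q A` has derivative `φ ∘ (id − 0) + 0 = φ` at `0`
  have hid : HasFDerivAt (fun A : E => A - Dt A) ((ContinuousLinearMap.id ℝ E) - 0) 0 :=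
    (hasFDerivAt_id (0 : E)).sub hDt
  have hφ : HasFDerivAt (fun A : E => φ (A - Dt A)) (φ.comp ((ContinuousLinearMap.id ℝ E) - 0)) 0 :=
    φ.hasFDerivAt.comp (0 : E) hid
  have hg : HasFDerivAt (fun A : E => f 0 + φ (A - Dt A) + q A)
      (φ.comp ((ContinuousLinearMap.id ℝ E) - 0) + 0) 0 :=
    ((hasFDerivAt_const (f 0) (0 : E)).add hφ).add hq |>.congr_fderiv (by simp)
  have hg' : HasFDerivAt (fun A : E => f 0 + φ (A - Dt A) + q A) φ 0 :=
    hg.congr_fderiv (by ext v; simp)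
  exact hg'.congr_of_eventuallyEq (h26.mono fun A hA => hA)

/-- **`J ⟂ S`**: under the expansion of (26) of [7] (as in `hasFDerivAt_of_expansion26`) and the minimum at `A = 0` on
the constraint subspace `S` near `0`, `φ v = ⟨v, J⟩ = 0` for every `v ∈ S` — this is WHY (19) carries the linear term
of (26) only as `−⟨D̃(A), J⟩`. [cite: Balaban1985UV3, (19) p.261] -/
theorem inner_J_eq_zero_of_expansion26 (S : Submodule ℝ E) {f q : E → ℝ} {Dt : E → E} (φ : E →L[ℝ] ℝ)
    (h26 : ∀ᶠ A in 𝓝 (0 : E), f A = f 0 + φ (A - Dt A) + q A)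
    (hDt : HasFDerivAt Dt (0 : E →L[ℝ] E) 0) (hq : HasFDerivAt q (0 : E →L[ℝ] ℝ) 0)
    {r : ℝ} (hr : 0 < r) (hmin : ∀ A ∈ S, ‖A‖ < r → f 0 ≤ f A) :
    ∀ v ∈ S, φ v = 0 :=
  fderiv_apply_eq_zero_of_minOn_subspace S (hasFDerivAt_of_expansion26 φ h26 hDt hq) hr hmin

/-- **THE SHAPE OF (19) ON THE CONSTRAINT SPACE**: with `φ|_S = 0`, for `A ∈ S` (near `0`, where (26) holds) the
expansion reads `f(A) = f(0) − φ(D̃ A) + q(A)` — «A(U₁) − ⟨D̃(A), J⟩ + ½⟨A − D̃(A), Δ(U₁)(A − D̃(A))⟩ + V₀(A − D̃(A))».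
[cite: Balaban1985UV3, (19) p.261] -/
theorem linear_term_absent_19 (S : Submodule ℝ E) {f q : E → ℝ} {Dt : E → E} (φ : E →L[ℝ] ℝ)
    (hφS : ∀ v ∈ S, φ v = 0) {A : E} (hA : A ∈ S) (h26A : f A = f 0 + φ (A - Dt A) + q A) :
    f A = f 0 - φ (Dt A) + q A := by
  rw [h26A, map_sub, hφS A hA]
  ring

end Expansion26

/-! ## §4 Knit with the tree's (17): `D̃′(0) = 0` from `Eq17Local` for the support operator `hD̃` of p. 260 -/

section Knit

open B13PkLocalTerms (hOp)
open B10Eq17LocalSolution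

variable {β C X : Type*} [Fintype β] [Fintype C] [NormedAddCommGroup X] [NormedSpace ℝ X]

/-- **`(hD̃)′(0) = 0`** on the bond-field space `β → X`: from the clause «Taylor expansion beginning with second order
terms» of (17) in the tree's local reading (`Eq17Local ℝ …`: `HasFDerivAt D̃ 0 0`) and the bounded linear support
operator `h` of p. 260 (`hOpLin`, `‖hD‖ ≤ b‖D‖`), the map `A ↦ hD̃(A)` entering `A − D̃(A)` has zero derivative at `0`.
[cite: Balaban1985UV3, (17) p.260] -/
theorem fderiv_hOp_Dt_zero {b₀ : C → β} {h : C → X →ₗ[ℝ] X} {Ct : (β → X) → C → X} {r δ : ℝ}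
    {Dt : (β → X) → C → X} (h17 : Eq17Local ℝ b₀ (fun c => ⇑(h c)) Ct r δ Dt) {b : ℝ} (hb : 0 ≤ b)
    (hh : ∀ c x, ‖h c x‖ ≤ b * ‖x‖) :
    HasFDerivAt (fun A : β → X => hOp b₀ (fun c => ⇑(h c)) (Dt A)) (0 : (β → X) →L[ℝ] (β → X)) 0 := by
  have hD : HasFDerivAt Dt (0 : (β → X) →L[ℝ] (C → X)) 0 := h17.2.2.2.2.2
  have hT := ((hOpLin b₀ h).mkContinuous b (norm_hOpLin_le b₀ h hb hh)).hasFDerivAt.comp (0 : β → X) hD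
  rw [ContinuousLinearMap.comp_zero] at hT
  exact hT

/-- `hD̃(0) = 0` (from `D̃(0) = 0` of `Eq17Local` and linearity of `h`). [cite: Balaban1985UV3, (17) p.260] -/
theorem hOp_Dt_zero {b₀ : C → β} {h : C → X →ₗ[ℝ] X} {Ct : (β → X) → C → X} {r δ : ℝ}
    {Dt : (β → X) → C → X} (h17 : Eq17Local ℝ b₀ (fun c => ⇑(h c)) Ct r δ Dt) :
    hOp b₀ (fun c => ⇑(h c)) (Dt 0) = 0 := by
  rw [h17.2.2.2.2.1, ← hOpLin_apply, map_zero]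

/-- **p. 260 END TO END with the tree's (17)**: on the bond-field space `β → X` with constraint subspace `S` (print:
`δ(QA)δ_{Ax}(A)`), if the function in the exponential expands as in (26) of [7] with `D̃` replaced by the support
operator `hD̃` of the `Eq17Local` solution, the higher terms `q` have zero derivative at `0`, and the function has a
minimum at `0` on `S` near `0` ((12) via the chart), then `φ v = ⟨v, J⟩ = 0` for all `v ∈ S`.
[cite: Balaban1985UV3, (19) p.261] -/
theorem inner_J_eq_zero_of_eq17Local (S : Submodule ℝ (β → X)) {b₀ : C → β} {h : C → X →ₗ[ℝ] X}
    {Ct : (β → X) → C → X} {r δ : ℝ} {Dt : (β → X) → C → X}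
    (h17 : Eq17Local ℝ b₀ (fun c => ⇑(h c)) Ct r δ Dt) {b : ℝ} (hb : 0 ≤ b) (hh : ∀ c x, ‖h c x‖ ≤ b * ‖x‖)
    {f q : (β → X) → ℝ} (φ : (β → X) →L[ℝ] ℝ)
    (h26 : ∀ᶠ A in 𝓝 (0 : β → X), f A = f 0 + φ (A - hOp b₀ (fun c => ⇑(h c)) (Dt A)) + q A)
    (hq : HasFDerivAt q (0 : (β → X) →L[ℝ] ℝ) 0)
    {ρ : ℝ} (hρ : 0 < ρ) (hmin : ∀ A ∈ S, ‖A‖ < ρ → f 0 ≤ f A) :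
    ∀ v ∈ S, φ v = 0 :=
  inner_J_eq_zero_of_expansion26 S φ h26 (fderiv_hOp_Dt_zero h17 hb hh) hq hρ hmin

end Knit

/-! ## §5 (v1.1) (19) END TO END on the carrier of [7] (26): the expansion hypotheses supplied BY NAME from B11

On the finite-lattice carrier of [5] (3.10)–(3.12) (`B9Eq39Adjoint`: `action`, `prodCfg`, `bondPair`, `J`) the B11
block's `B11Eq26FirstVariation.expansion26_real` (r08, p308406) PRODUCES, for any `D̃` with `D̃(0) = 0`, `D̃′(0) = 0`,
the data `φ = Re⟨·, J⟩`, `q` with `q′(0) = 0` and the identity `f(A) = f(0) + φ(A − D̃A) + q(A)` for the real function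
`f(A) = Re A(exp iη(A − D̃A)·U₁)` — verbatim the hypotheses `h26`, `hq` of §3.  Feeding them in leaves the p. 260
sentence with ONE hypothesis, its own first half «has a minimum at A = 0» on the constraint space (`hmin`, = (12) along
the chart, §2), and yields its second half in the (19) form: `⟨v, J⟩ = 0` on the constraint space, hence no `⟨A, J⟩`
term in (19). -/

section B11Carrier

open B9Eq39Adjoint B11Eq26FirstVariation

variable {𝔸 : Type*} [NormedRing 𝔸] [NormedAlgebra ℂ 𝔸] [CompleteSpace 𝔸]
variable {S : Type*} [Fintype S] {ι : Type*} [Fintype ι] [LinearOrder ι]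
variable (T : ι → Equiv.Perm S) (U : ι → S → 𝔸ˣ)

/-- **THE REAL FERMAT CONCLUSION ON THE CARRIER** (any background `U₁`, any tracial `τ`): if the function in the
exponential `f(A) = Re A(exp iη(A − D̃A)·U₁)` — `D̃(0) = 0`, `D̃′(0) = 0` as in (17) — has a minimum at `A = 0` on the
constraint subspace `S` near `0`, then `Re⟨v, J⟩ = 0` for every `v ∈ S`: the linear term of (26) vanishes on `S`.
[cite: Balaban1985UV3, p.260 (before (19))] [cite: Balaban1985Variational, (26)-(27) p.282] -/
theorem re_inner_J_eq_zero_b11 (τ : 𝔸 →L[ℂ] ℂ) (hτ : ∀ a b : 𝔸, τ (a * b) = τ (b * a)) (η : ℝ) (hη : η ≠ 0)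
    {d : ℕ} (hd : 4 ≤ d) {Dt : (ι → S → 𝔸) → (ι → S → 𝔸)} (hDt0 : Dt 0 = 0)
    (hDt : HasFDerivAt Dt (0 : (ι → S → 𝔸) →L[ℝ] (ι → S → 𝔸)) 0)
    (Sc : Submodule ℝ (ι → S → 𝔸)) {r : ℝ} (hr : 0 < r)
    (hmin : ∀ A ∈ Sc, ‖A‖ < r →
      (action T η d (τ : 𝔸 →ₗ[ℂ] ℂ) (prodCfg U η (0 - Dt 0))).re
        ≤ (action T η d (τ : 𝔸 →ₗ[ℂ] ℂ) (prodCfg U η (A - Dt A))).re) :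
    ∀ v ∈ Sc, (bondPair η d (τ : 𝔸 →ₗ[ℂ] ℂ) v (J T U η)).re = 0 := by
  obtain ⟨φ, q, hφ, hq, h26⟩ := expansion26_real T U τ hτ η hη hd hDt0 hDt
  have hφS := inner_J_eq_zero_of_expansion26 Sc φ
    (f := fun A => (action T η d (τ : 𝔸 →ₗ[ℂ] ℂ) (prodCfg U η (A - Dt A))).re)
    (Filter.Eventually.of_forall h26) hDt hq hr hmin
  intro v hv
  rw [← hφ v]
  exact hφS v hv

/-- **THE PRINTED SHAPE OF (19) ON THE CARRIER**: under the same minimum, for `A` in the constraint space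
`Re A(exp iη(A − D̃A)·U₁) = Re A(U₁) − Re⟨D̃A, J⟩ + q(A)` with `q′(0) = 0` — «A(U₁) − ⟨D̃(A), J⟩ + ½⟨A − D̃(A),
Δ(U₁)(A − D̃(A))⟩ + V₀(A − D̃(A))», no `⟨A, J⟩` term. [cite: Balaban1985UV3, (19) p.261]
[cite: Balaban1985Variational, (26)-(27) p.282] -/
theorem expansion19_b11 (τ : 𝔸 →L[ℂ] ℂ) (hτ : ∀ a b : 𝔸, τ (a * b) = τ (b * a)) (η : ℝ) (hη : η ≠ 0)
    {d : ℕ} (hd : 4 ≤ d) {Dt : (ι → S → 𝔸) → (ι → S → 𝔸)} (hDt0 : Dt 0 = 0)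
    (hDt : HasFDerivAt Dt (0 : (ι → S → 𝔸) →L[ℝ] (ι → S → 𝔸)) 0)
    (Sc : Submodule ℝ (ι → S → 𝔸)) {r : ℝ} (hr : 0 < r)
    (hmin : ∀ A ∈ Sc, ‖A‖ < r →
      (action T η d (τ : 𝔸 →ₗ[ℂ] ℂ) (prodCfg U η (0 - Dt 0))).re
        ≤ (action T η d (τ : 𝔸 →ₗ[ℂ] ℂ) (prodCfg U η (A - Dt A))).re) :
    ∃ q : (ι → S → 𝔸) → ℝ, HasFDerivAt q (0 : (ι → S → 𝔸) →L[ℝ] ℝ) 0 ∧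
      ∀ A ∈ Sc, (action T η d (τ : 𝔸 →ₗ[ℂ] ℂ) (prodCfg U η (A - Dt A))).re
        = (action T η d (τ : 𝔸 →ₗ[ℂ] ℂ) U).re - (bondPair η d (τ : 𝔸 →ₗ[ℂ] ℂ) (Dt A) (J T U η)).re + q A := by
  obtain ⟨φ, q, hφ, hq, h26⟩ := expansion26_real T U τ hτ η hη hd hDt0 hDt
  have hφS := inner_J_eq_zero_of_expansion26 Sc φ
    (f := fun A => (action T η d (τ : 𝔸 →ₗ[ℂ] ℂ) (prodCfg U η (A - Dt A))).re)
    (Filter.Eventually.of_forall h26) hDt hq hr hmin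
  refine ⟨q, hq, fun A hA => ?_⟩
  have h19 := linear_term_absent_19 Sc φ hφS hA
    (f := fun A => (action T η d (τ : 𝔸 →ₗ[ℂ] ℂ) (prodCfg U η (A - Dt A))).re) (h26 A)
  rw [hDt0, sub_zero, B9Eq369Product.prodCfg_zero, hφ (Dt A)] at h19
  exact h19

section Hermitian

variable [StarRing 𝔸] [StarModule ℂ 𝔸]

/-- **p. 260 ⇒ (19), END TO END MODULO THE MINIMUM**: over a UNITARY background (`U₁(b)⁻¹ = U₁(b)*`), with a tracial
`*`-compatible `τ` and a real constraint subspace `S` of HERMITIAN bond fields (print: `ker Q ∩ {axial gauge}` in 𝔤),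
the minimum at `A = 0` of `A ↦ Re A(exp iη(A − D̃A)·U₁)` on `S` near `0` (`D̃(0) = 0`, `D̃′(0) = 0`) gives `⟨v, J⟩ = 0`
for every `v ∈ S` — the linear term of (26) is absent from (19).  (B11 supplies (26) as the first variation and
(27)–(28) «from hermiticity»; B10 supplies Fermat along `S`.) [cite: Balaban1985UV3, p.260 (before (19)), (19) p.261]
[cite: Balaban1985Variational, (26)-(28) p.282] -/
theorem inner_J_eq_zero_b11 (hU : ∀ μ x, (((U μ x)⁻¹ : 𝔸ˣ) : 𝔸) = star (U μ x : 𝔸)) (τ : 𝔸 →L[ℂ] ℂ)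
    (hτ : ∀ a b : 𝔸, τ (a * b) = τ (b * a)) (hτs : ∀ a : 𝔸, τ (star a) = starRingEnd ℂ (τ a)) (η : ℝ)
    (hη : η ≠ 0) {d : ℕ} (hd : 4 ≤ d) {Dt : (ι → S → 𝔸) → (ι → S → 𝔸)} (hDt0 : Dt 0 = 0)
    (hDt : HasFDerivAt Dt (0 : (ι → S → 𝔸) →L[ℝ] (ι → S → 𝔸)) 0)
    (Sc : Submodule ℝ (ι → S → 𝔸)) (hS : ∀ v ∈ Sc, ∀ μ x, star (v μ x) = v μ x) {r : ℝ} (hr : 0 < r)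
    (hmin : ∀ A ∈ Sc, ‖A‖ < r →
      (action T η d (τ : 𝔸 →ₗ[ℂ] ℂ) (prodCfg U η (0 - Dt 0))).re
        ≤ (action T η d (τ : 𝔸 →ₗ[ℂ] ℂ) (prodCfg U η (A - Dt A))).re) :
    ∀ v ∈ Sc, bondPair η d (τ : 𝔸 →ₗ[ℂ] ℂ) v (J T U η) = 0 :=
  bondPair_J_eq_zero_on T U hU (τ : 𝔸 →ₗ[ℂ] ℂ) hτ hτs η d Sc hS
    (re_inner_J_eq_zero_b11 T U τ hτ η hη hd hDt0 hDt Sc hr hmin)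

open B13PkLocalTerms (hOp)
open B10Eq17LocalSolution

/-- **THE SAME WITH THE TREE'S (17)**: `D̃` = the support operator `h` of p. 260 applied to the `Eq17Local ℝ` solution
`Dt` of (17) (on [7]'s bond-field coordinates `β → X`, coarse bonds `C`), read in the carrier's coordinates through
continuous linear identifications `e : (β → X) → (ι → S → 𝔸)`, `e′` back (e.g. uncurrying for `β = ι × S`, `X = 𝔸`):
`D̃ A = e(hD̃t(e′A))` has `D̃(0) = 0` and `D̃′(0) = 0` from `Eq17Local` («Taylor expansion beginning with second order
terms»), so the minimum on `S` alone gives `⟨v, J⟩ = 0` on `S`. [cite: Balaban1985UV3, (17) p.260, (19) p.261]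
[cite: Balaban1985Variational, (26)-(28) p.282] -/
theorem inner_J_eq_zero_b11_of_eq17Local (hU : ∀ μ x, (((U μ x)⁻¹ : 𝔸ˣ) : 𝔸) = star (U μ x : 𝔸))
    (τ : 𝔸 →L[ℂ] ℂ) (hτ : ∀ a b : 𝔸, τ (a * b) = τ (b * a)) (hτs : ∀ a : 𝔸, τ (star a) = starRingEnd ℂ (τ a))
    (η : ℝ) (hη : η ≠ 0) {d : ℕ} (hd : 4 ≤ d)
    {β C X : Type*} [Fintype β] [Fintype C] [NormedAddCommGroup X] [NormedSpace ℝ X]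
    {b₀ : C → β} {h : C → X →ₗ[ℝ] X} {Ct : (β → X) → C → X} {r₁ δ : ℝ} {Dt : (β → X) → C → X}
    (h17 : Eq17Local ℝ b₀ (fun c => ⇑(h c)) Ct r₁ δ Dt) {b : ℝ} (hb : 0 ≤ b) (hh : ∀ c x, ‖h c x‖ ≤ b * ‖x‖)
    (e : (β → X) →L[ℝ] (ι → S → 𝔸)) (e' : (ι → S → 𝔸) →L[ℝ] (β → X))
    (Sc : Submodule ℝ (ι → S → 𝔸)) (hS : ∀ v ∈ Sc, ∀ μ x, star (v μ x) = v μ x) {r : ℝ} (hr : 0 < r)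
    (hmin : ∀ A ∈ Sc, ‖A‖ < r →
      (action T η d (τ : 𝔸 →ₗ[ℂ] ℂ)
          (prodCfg U η (0 - e (hOp b₀ (fun c => ⇑(h c)) (Dt (e' 0)))))).re
        ≤ (action T η d (τ : 𝔸 →ₗ[ℂ] ℂ)
          (prodCfg U η (A - e (hOp b₀ (fun c => ⇑(h c)) (Dt (e' A)))))).re) :
    ∀ v ∈ Sc, bondPair η d (τ : 𝔸 →ₗ[ℂ] ℂ) v (J T U η) = 0 := by
  -- `D̃(0) = 0`
  have hD0 : (fun A : ι → S → 𝔸 => e (hOp b₀ (fun c => ⇑(h c)) (Dt (e' A)))) 0 = 0 := by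
    simp only [map_zero, hOp_Dt_zero h17]
  -- `D̃′(0) = 0` by the chain rule around `fderiv_hOp_Dt_zero`
  have hD : HasFDerivAt (fun A : β → X => hOp b₀ (fun c => ⇑(h c)) (Dt A))
      (0 : (β → X) →L[ℝ] (β → X)) (e' 0) := by
    rw [map_zero]; exact fderiv_hOp_Dt_zero h17 hb hh
  have h1 : HasFDerivAt (fun A : ι → S → 𝔸 => hOp b₀ (fun c => ⇑(h c)) (Dt (e' A)))
      (0 : (ι → S → 𝔸) →L[ℝ] (β → X)) 0 :=
    (hD.comp (0 : ι → S → 𝔸) e'.hasFDerivAt).congr_fderiv (by simp)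
  have h2 : HasFDerivAt (fun A : ι → S → 𝔸 => e (hOp b₀ (fun c => ⇑(h c)) (Dt (e' A))))
      (0 : (ι → S → 𝔸) →L[ℝ] (ι → S → 𝔸)) 0 :=
    (e.hasFDerivAt.comp (0 : ι → S → 𝔸) h1).congr_fderiv (by simp)
  exact inner_J_eq_zero_b11 T U hU τ hτ hτs η hη hd hD0 h2 Sc hS hr hmin

end Hermitian

end B11Carrier

/-! ## §6 (v1.2) STEP k (p. 268–269, (52)–(53)): the minimality of `V^{(k)}` ⇒ the orthogonality relation
`⟨H₁A, J⟩ = 0` of (53) on the constraint space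

p. 268 [PDF 14] (held text layer; render `…-p014-x2.png` read as image by this seat in gen 14): *«The integral (49) is
calculated by the saddle point method. We take the minimal configuration V^{(k)} of the functional A^η(U_k), which
satisfies the conditions V^{(k)}↾Z_k = V_k↾Z_k, V̄^{(k)} = V on Λ_{k+1}. If we substitute it in U_k in place of
V_k↾Λ_k, we get the configuration U_{k+1}. … Now we expand the action in A. Using the results of Sect. G [7] we write
U_k(exp i(A − D̃(A))V^{(k)}) = exp iη𝓗(A − D̃(A))U_{k+1} (modulo a gauge transformation), (52) where 𝓗(B) is
determined by Eqs. (174), (175) [7]. Next using the gauge invariance of the action, the expansion (26), Eq. (174), and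
the formulas (74), (78)–(81) of [7], we get»* (53), p. 269 [PDF 15]: *«We have used also orthogonality relations
following from the definitions of operations and configurations used above.»*

With (174) of [7], `𝓗(B) = 𝒜₁(B) + H₁B − HD(𝒜₁(B) + H₁B)`, the step-k «function in the exponential» of (51) is
`f(A) = 𝔉(𝒜₁(A − D̃A) + H₁(A − D̃A))`, where `𝔉(A′) = A^η(exp(iη(A′ − HD(A′)))U_{k+1})` is the functional (74) of [7]
at the base point `U₀ = U_{k+1}` (derivative `⟨·, J⟩` at `A′ = 0`: (81) with (84) and (98), «the first order term is
… ⟨A′, J⟩» p. 290 of [7]), `𝒜₁` is of SECOND order at `B = 0` ((176) of [7]: «it begins with a term of second order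
in H₁B») and `D̃` is of second order ((17) at step k, (50)).  Exactly as at the first step (§2–§3): `V^{(k)}` minimal
among the regular configurations with `V̄ = V` on `Λ_{k+1}` in the axial gauge, `U_{k+1} = U_k(V^{(k)})`, and the chart
`A ↦ exp(i(A − D̃(A)))V^{(k)}` keeping these constraints for `A` in the constraint space `S` of `δ(Q_kA)δ_{Ax}(A)`
((50)–(51)) give `f(0) ≤ f(A)` on `S` near `0`; Fermat along `S` (§1) kills the derivative `⟨H₁·, J⟩` of `f` on `S`.
That is the FIRST of the three located «orthogonality relations» of (53) — the conjunct `⟪H₁A, J⟫ = 0` of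
`B10SectCExpansion.Orthogonality53` (row B10.Eq53, this seat gen 1) —, a theorem modulo the minimality of `V^{(k)}`;
the other two (`⟨𝓗₁, J⟩ = 0`, the cross term with `Δ₁𝓗₁`) are Sect. G of [7] (`B11Eq177FirstOrder`, HONEST SCOPE
(iii) there).  [folklore] calculus: the chain rule at `0` and §1. -/

section StepK

variable {E F' : Type*} [NormedAddCommGroup E] [NormedSpace ℝ E] [NormedAddCommGroup F'] [NormedSpace ℝ F']

/-- the step-k chart before the Sect. C map, `A ↦ 𝒜₁(A − D̃A) + H₁(A − D̃A)` (the argument of the functional (74) in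
(52)–(53)), has derivative `H₁` at `0` when `𝒜₁` and `D̃` vanish to second order at `0` ((176)–(177) of [7]: «the
expansion of 𝓗 begins with the first order term H₁B»; (17)/(50) for `D̃`).
[cite: Balaban1985UV3, (52)-(53) p.268-269] [cite: Balaban1985Variational, (176)-(177) p.306] -/
theorem hasFDerivAt_chart_stepk (H₁ : E →L[ℝ] F') {𝒜₁ : E → F'} (h𝒜 : HasFDerivAt 𝒜₁ (0 : E →L[ℝ] F') 0)
    {Dt : E → E} (hDt0 : Dt 0 = 0) (hDt : HasFDerivAt Dt (0 : E →L[ℝ] E) 0) :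
    HasFDerivAt (fun A : E => 𝒜₁ (A - Dt A) + H₁ (A - Dt A)) H₁ 0 := by
  have hg : HasFDerivAt (fun A : E => A - Dt A) (ContinuousLinearMap.id ℝ E - 0) 0 :=
    (hasFDerivAt_id (0 : E)).sub hDt
  have hg0 : (fun A : E => A - Dt A) 0 = 0 := by simp [hDt0]
  have h𝒜' : HasFDerivAt 𝒜₁ (0 : E →L[ℝ] F') ((fun A : E => A - Dt A) 0) := by rw [hg0]; exact h𝒜
  have h1 : HasFDerivAt (fun A : E => 𝒜₁ (A - Dt A))
      ((0 : E →L[ℝ] F').comp (ContinuousLinearMap.id ℝ E - 0)) 0 := h𝒜'.comp (0 : E) hg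
  have h2 : HasFDerivAt (fun A : E => H₁ (A - Dt A)) (H₁.comp (ContinuousLinearMap.id ℝ E - 0)) 0 :=
    H₁.hasFDerivAt.comp (0 : E) hg
  exact (h1.add h2).congr_fderiv (by ext v; simp)

/-- **the step-k function in the exponential has derivative `⟨H₁·, J⟩` at `A = 0`**: with `𝔉` real-differentiable at
`0` with derivative `φ` (print: the functional (74) = (81) of [7] at `U₀ = U_{k+1}`, `φ = ⟨·, J⟩` by (84)/(98)),
`f(A) = 𝔉(𝒜₁(A − D̃A) + H₁(A − D̃A))` has derivative `φ ∘ H₁` at `0` (chain rule with `hasFDerivAt_chart_stepk`).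
[cite: Balaban1985UV3, (53) p.269] [cite: Balaban1985Variational, (174)-(177) p.305-306, (81)-(84) p.290] -/
theorem hasFDerivAt_action_stepk (H₁ : E →L[ℝ] F') {𝒜₁ : E → F'} (h𝒜0 : 𝒜₁ 0 = 0)
    (h𝒜 : HasFDerivAt 𝒜₁ (0 : E →L[ℝ] F') 0) {Dt : E → E} (hDt0 : Dt 0 = 0)
    (hDt : HasFDerivAt Dt (0 : E →L[ℝ] E) 0) {𝔉 : F' → ℝ} {φ : F' →L[ℝ] ℝ} (h𝔉 : HasFDerivAt 𝔉 φ 0) :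
    HasFDerivAt (fun A : E => 𝔉 (𝒜₁ (A - Dt A) + H₁ (A - Dt A))) (φ.comp H₁) 0 := by
  have hc := hasFDerivAt_chart_stepk H₁ h𝒜 hDt0 hDt
  have h0 : (fun A : E => 𝒜₁ (A - Dt A) + H₁ (A - Dt A)) 0 = 0 := by simp [hDt0, h𝒜0]
  have h𝔉' : HasFDerivAt 𝔉 φ ((fun A : E => 𝒜₁ (A - Dt A) + H₁ (A - Dt A)) 0) := by rw [h0]; exact h𝔉
  exact h𝔉'.comp (0 : E) hc

/-- **STEP k: `⟨H₁v, J⟩ = 0` ON THE CONSTRAINT SPACE** — «We take the minimal configuration V^{(k)} of the functional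
A^η(U_k) …» (p. 268) ⇒ the first located orthogonality relation of (53): if the action along the step-k chart
`f(A) = 𝔉(𝒜₁(A − D̃A) + H₁(A − D̃A))` (`𝒜₁`, `D̃` of second order at `0`, `𝔉′(0) = φ = ⟨·, J⟩`) satisfies
`f(0) ≤ f(A)` for `A ∈ S`, `|A| < r` (minimality of `U_{k+1} = U_k(V^{(k)})` under the constraints, kept by the chart
by (50)), then `φ(H₁v) = 0` for every `v ∈ S`. [cite: Balaban1985UV3, p.268, (53) p.269]
[cite: Balaban1985Variational, (170) p.305, (174)-(177) p.305-306] -/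
theorem inner_H1_J_eq_zero_stepk (S : Submodule ℝ E) (H₁ : E →L[ℝ] F') {𝒜₁ : E → F'} (h𝒜0 : 𝒜₁ 0 = 0)
    (h𝒜 : HasFDerivAt 𝒜₁ (0 : E →L[ℝ] F') 0) {Dt : E → E} (hDt0 : Dt 0 = 0)
    (hDt : HasFDerivAt Dt (0 : E →L[ℝ] E) 0) {𝔉 : F' → ℝ} {φ : F' →L[ℝ] ℝ} (h𝔉 : HasFDerivAt 𝔉 φ 0)
    {r : ℝ} (hr : 0 < r)
    (hmin : ∀ A ∈ S, ‖A‖ < r →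
      𝔉 (𝒜₁ (0 - Dt 0) + H₁ (0 - Dt 0)) ≤ 𝔉 (𝒜₁ (A - Dt A) + H₁ (A - Dt A))) :
    ∀ v ∈ S, φ (H₁ v) = 0 := by
  intro v hv
  have h := fderiv_apply_eq_zero_of_minOn_subspace S
    (f := fun A : E => 𝔉 (𝒜₁ (A - Dt A) + H₁ (A - Dt A)))
    (hasFDerivAt_action_stepk H₁ h𝒜0 h𝒜 hDt0 hDt h𝔉) hr hmin v hv
  simpa using h

/-- **THE LINEAR TERM OF (53) ON THE CONSTRAINT SPACE**: under the same minimum there is `q` with `q′(0) = 0` such that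
for `A ∈ S`, `f(A) = f(0) − φ(H₁D̃(A)) + q(A)` — of the first-order term `⟨H₁(A − D̃(A)), J⟩` of the second member of
(53) only `−⟨H₁D̃(A), J⟩` survives in the third member (printed as `−⟨H₁D̃⁽²⁾(A), J⟩ − ⟨H₁D̃₃(A), J⟩`, `D̃ = D̃⁽²⁾ +
D̃₃`). [cite: Balaban1985UV3, (53) p.269] -/
theorem expansion53_linear_stepk (S : Submodule ℝ E) (H₁ : E →L[ℝ] F') {𝒜₁ : E → F'} (h𝒜0 : 𝒜₁ 0 = 0)
    (h𝒜 : HasFDerivAt 𝒜₁ (0 : E →L[ℝ] F') 0) {Dt : E → E} (hDt0 : Dt 0 = 0)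
    (hDt : HasFDerivAt Dt (0 : E →L[ℝ] E) 0) {𝔉 : F' → ℝ} {φ : F' →L[ℝ] ℝ} (h𝔉 : HasFDerivAt 𝔉 φ 0)
    {r : ℝ} (hr : 0 < r)
    (hmin : ∀ A ∈ S, ‖A‖ < r →
      𝔉 (𝒜₁ (0 - Dt 0) + H₁ (0 - Dt 0)) ≤ 𝔉 (𝒜₁ (A - Dt A) + H₁ (A - Dt A))) :
    ∃ q : E → ℝ, HasFDerivAt q (0 : E →L[ℝ] ℝ) 0 ∧
      ∀ A ∈ S, 𝔉 (𝒜₁ (A - Dt A) + H₁ (A - Dt A))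
        = 𝔉 (𝒜₁ (0 - Dt 0) + H₁ (0 - Dt 0)) - φ (H₁ (Dt A)) + q A := by
  have hφS := inner_H1_J_eq_zero_stepk S H₁ h𝒜0 h𝒜 hDt0 hDt h𝔉 hr hmin
  have hfd := hasFDerivAt_action_stepk H₁ h𝒜0 h𝒜 hDt0 hDt h𝔉
  have hg : HasFDerivAt (fun A : E => A - Dt A) (ContinuousLinearMap.id ℝ E - 0) 0 :=
    (hasFDerivAt_id (0 : E)).sub hDt
  have hL : HasFDerivAt (fun A : E => φ (H₁ (A - Dt A)))
      ((φ.comp H₁).comp (ContinuousLinearMap.id ℝ E - 0)) 0 :=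
    (φ.comp H₁).hasFDerivAt.comp (0 : E) hg
  refine ⟨fun A => 𝔉 (𝒜₁ (A - Dt A) + H₁ (A - Dt A)) - 𝔉 (𝒜₁ (0 - Dt 0) + H₁ (0 - Dt 0))
      - φ (H₁ (A - Dt A)), ?_, fun A hA => ?_⟩
  · -- `q′(0) = φ∘H₁ − φ∘H₁∘(id − 0) = 0`
    have h := (hfd.sub_const (𝔉 (𝒜₁ (0 - Dt 0) + H₁ (0 - Dt 0)))).sub hL
    exact h.congr_fderiv (by ext v; simp)
  · have hlin : φ (H₁ (A - Dt A)) = -φ (H₁ (Dt A)) := by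
      rw [map_sub, map_sub, hφS A hA, zero_sub]
    beta_reduce
    rw [hlin]
    ring

end StepK

/-! ### §6b Row B10.Eq53 in its own letters: the conjunct `⟪H₁A, J⟫ = 0` of `Orthogonality53` -/

section Row53

open scoped RealInnerProductSpace
open B10SectCExpansion (ExpansionData)

variable {F F' : Type*} [NormedAddCommGroup F] [InnerProductSpace ℝ F] [NormedAddCommGroup F']
  [InnerProductSpace ℝ F']

/-- **ROW B10.Eq53: the conjunct `⟪H₁A, J⟫ = 0` of `B10SectCExpansion.Orthogonality53` DISCHARGED modulo the
minimality of `V^{(k)}`.**  In the letters of `ExpansionData` (`H₁`, `J`, `D = D̃`, `actFl A = A^η(U_k(exp i(A −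
D̃(A))V^{(k)}))`): if `actFl` IS the action along the step-k chart, `actFl A = 𝔉(𝒜₁(A − D̃A) + H₁(A − D̃A))` ((52) with
(174) of [7]) with `𝔉′(0) = ⟨·, J⟩` ((74)/(81)/(84) of [7] at `U₀ = U_{k+1}`), `𝒜₁(0) = 0`, `𝒜₁′(0) = 0` ((176)),
`D̃(0) = 0`, `D̃′(0) = 0` ((17)/(50)), `H₁` continuous (print: finite lattices), and `actFl 0 ≤ actFl A` for `A` in the
constraint subspace `S` with `|A| < r` (p. 268: `V^{(k)}` minimal), then `⟪H₁A, J⟫ = 0` for all `A ∈ S` — in particular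
on the support of `χδ(Q_kA)δ_{Ax}(A)` (⊆ `S`), the set over which `Orthogonality53` quantifies.
[cite: Balaban1985UV3, p.268, (53) p.269] [cite: Balaban1985Variational, (174)-(177) p.305-306] -/
theorem orthogonality53_inner_H1_J (d : ExpansionData F F') (hH₁ : Continuous d.H₁) {𝔉 : F' → ℝ}
    (h𝔉 : HasFDerivAt 𝔉 (innerSL ℝ d.J) 0) {𝒜₁ : F → F'} (h𝒜0 : 𝒜₁ 0 = 0)
    (h𝒜 : HasFDerivAt 𝒜₁ (0 : F →L[ℝ] F') 0) (hD0 : d.D 0 = 0) (hD : HasFDerivAt d.D (0 : F →L[ℝ] F) 0)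
    (hact : ∀ A, d.actFl A = 𝔉 (𝒜₁ (A - d.D A) + d.H₁ (A - d.D A)))
    (S : Submodule ℝ F) {r : ℝ} (hr : 0 < r) (hmin : ∀ A ∈ S, ‖A‖ < r → d.actFl 0 ≤ d.actFl A) :
    ∀ A ∈ S, ⟪d.H₁ A, d.J⟫ = 0 := by
  let H₁L : F →L[ℝ] F' := ⟨d.H₁, hH₁⟩
  have hmin' : ∀ A ∈ S, ‖A‖ < r →
      𝔉 (𝒜₁ (0 - d.D 0) + H₁L (0 - d.D 0)) ≤ 𝔉 (𝒜₁ (A - d.D A) + H₁L (A - d.D A)) := by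
    intro A hA hAr
    have h := hmin A hA hAr
    rw [hact 0, hact A] at h
    exact h
  intro A hA
  have h := inner_H1_J_eq_zero_stepk S H₁L h𝒜0 h𝒜 hD0 hD h𝔉 hr hmin' A hA
  rw [innerSL_apply_apply] at h
  rw [real_inner_comm]
  exact h

/-- … hence that conjunct holds on ANY set `S′ ⊆ S` of admissible fields (the support of `χδ(Q_kA)δ_{Ax}(A)` in (51)),
in the exact shape `∀ A ∈ S′, ⟪H₁A, J⟫ = 0` in which `Orthogonality53 d S′` records it.
[cite: Balaban1985UV3, (53) p.269] -/
theorem orthogonality53_inner_H1_J_on (d : ExpansionData F F') (hH₁ : Continuous d.H₁) {𝔉 : F' → ℝ}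
    (h𝔉 : HasFDerivAt 𝔉 (innerSL ℝ d.J) 0) {𝒜₁ : F → F'} (h𝒜0 : 𝒜₁ 0 = 0)
    (h𝒜 : HasFDerivAt 𝒜₁ (0 : F →L[ℝ] F') 0) (hD0 : d.D 0 = 0) (hD : HasFDerivAt d.D (0 : F →L[ℝ] F) 0)
    (hact : ∀ A, d.actFl A = 𝔉 (𝒜₁ (A - d.D A) + d.H₁ (A - d.D A)))
    (S : Submodule ℝ F) {r : ℝ} (hr : 0 < r) (hmin : ∀ A ∈ S, ‖A‖ < r → d.actFl 0 ≤ d.actFl A)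
    {S' : Set F} (hS' : S' ⊆ (S : Set F)) :
    ∀ A ∈ S', ⟪d.H₁ A, d.J⟫ = 0 :=
  fun A hA => orthogonality53_inner_H1_J d hH₁ h𝔉 h𝒜0 h𝒜 hD0 hD hact S hr hmin A (hS' hA)

end Row53

/-! ### §6c END TO END in the Sect. E–G scheme of [7]: (176)–(177) by name from `B11Eq177FirstOrder` -/

section B11Scheme

open B11Eq174Chart (Regime)
open B11Eq183Differentiation (solA180)
open B11Eq177FirstOrder (expansion_firstOrder_comp)

variable {𝒳 𝒴 𝒵 : Type*} [NormedAddCommGroup 𝒳] [NormedSpace ℂ 𝒳] [NormedAddCommGroup 𝒴] [NormedSpace ℂ 𝒴]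
  [NormedAddCommGroup 𝒵] [NormedSpace ℂ 𝒵] [CompleteSpace 𝒳] [CompleteSpace 𝒴] [CompleteSpace 𝒵]
variable {𝒢 : 𝒵 →L[ℂ] 𝒴} {W : 𝒴 → 𝒵} {H₁ : 𝒳 →L[ℂ] 𝒴} {B₀ θ C₄ a₃ j a ε₄ : ℝ}

/-- **STEP k END TO END IN THE SECT. E–G SCHEME OF [7]** (`B11Eq174Chart.Regime` = the Prop. 6 regime letters,
`B11Eq183Differentiation.solA180 𝔊 ((δ/δA′)V) 0 H₁ ε₄` = `𝒜₁` of (175), Prop. 4 analyticity `hWa`): for any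
real-differentiable `𝔉` with derivative `φ` at `0` ((74)/(81): `φ = ⟨·, J⟩`) and `D̃` of second order at `0`, the
minimum at `A = 0` of `A ↦ 𝔉(𝒜₁(A − D̃A) + H₁(A − D̃A))` on the constraint space `S` near `0` (p. 268: `V^{(k)}`
minimal) gives `φ(H₁v) = 0` for every `v ∈ S` — «⟨H₁A, J⟩ = 0», the first orthogonality relation of (53).  The
first-order structure (176)–(177) is SUPPLIED BY NAME: `B11Eq177FirstOrder.expansion_firstOrder_comp` (r08, p311323)
produces verbatim the hypotheses `h26`/`hq` of §3 with the functional `φ ∘ H₁`.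
[cite: Balaban1985UV3, p.268, (52)-(53) p.268-269] [cite: Balaban1985Variational, (174)-(177) p.305-306] -/
theorem inner_H1_J_eq_zero_b11_scheme (R : Regime 𝒢 0 W B₀ θ C₄ a₃ j a ε₄)
    (hWa : AnalyticOnNhd ℂ W {Y : 𝒴 | ‖Y‖ < a₃}) (hj : 0 < j) (ha : 0 < a) {𝔉 : 𝒴 → ℝ} {φ : 𝒴 →L[ℝ] ℝ}
    (h𝔉 : HasFDerivAt 𝔉 φ 0) {Dt : 𝒳 → 𝒳} (hDt0 : Dt 0 = 0) (hDt : HasFDerivAt Dt (0 : 𝒳 →L[ℝ] 𝒳) 0)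
    (Sc : Submodule ℝ 𝒳) {r : ℝ} (hr : 0 < r)
    (hmin : ∀ A ∈ Sc, ‖A‖ < r →
      𝔉 (solA180 𝒢 W 0 H₁ ε₄ (0 - Dt 0) + H₁ (0 - Dt 0))
        ≤ 𝔉 (solA180 𝒢 W 0 H₁ ε₄ (A - Dt A) + H₁ (A - Dt A))) :
    ∀ v ∈ Sc, φ (H₁ v) = 0 := by
  obtain ⟨q, hq, h26⟩ := expansion_firstOrder_comp (H₁ := H₁) R hWa hj ha h𝔉 hDt0 hDt
  have hφS := inner_J_eq_zero_of_expansion26 Sc (φ ∘L (H₁.restrictScalars ℝ))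
    (f := fun A : 𝒳 => 𝔉 (solA180 𝒢 W 0 H₁ ε₄ (A - Dt A) + H₁ (A - Dt A)))
    (Filter.Eventually.of_forall h26) hDt hq hr hmin
  intro v hv
  simpa using hφS v hv

/-- **THE LINEAR TERM OF (53) IN THE SCHEME**: under the same minimum, with the `q` of `expansion_firstOrder_comp`
(`q′(0) = 0`), for `A ∈ S`: `𝔉(𝒜₁(A − D̃A) + H₁(A − D̃A)) = 𝔉(𝒜₁(0) + H₁0) − φ(H₁D̃(A)) + q(A)` — the third member of
(53) carries the first-order term only as `−⟨H₁D̃(A), J⟩`. [cite: Balaban1985UV3, (53) p.269]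
[cite: Balaban1985Variational, (174)-(177) p.305-306] -/
theorem expansion53_linear_b11_scheme (R : Regime 𝒢 0 W B₀ θ C₄ a₃ j a ε₄)
    (hWa : AnalyticOnNhd ℂ W {Y : 𝒴 | ‖Y‖ < a₃}) (hj : 0 < j) (ha : 0 < a) {𝔉 : 𝒴 → ℝ} {φ : 𝒴 →L[ℝ] ℝ}
    (h𝔉 : HasFDerivAt 𝔉 φ 0) {Dt : 𝒳 → 𝒳} (hDt0 : Dt 0 = 0) (hDt : HasFDerivAt Dt (0 : 𝒳 →L[ℝ] 𝒳) 0)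
    (Sc : Submodule ℝ 𝒳) {r : ℝ} (hr : 0 < r)
    (hmin : ∀ A ∈ Sc, ‖A‖ < r →
      𝔉 (solA180 𝒢 W 0 H₁ ε₄ (0 - Dt 0) + H₁ (0 - Dt 0))
        ≤ 𝔉 (solA180 𝒢 W 0 H₁ ε₄ (A - Dt A) + H₁ (A - Dt A))) :
    ∃ q : 𝒳 → ℝ, HasFDerivAt q (0 : 𝒳 →L[ℝ] ℝ) 0 ∧
      ∀ A ∈ Sc, 𝔉 (solA180 𝒢 W 0 H₁ ε₄ (A - Dt A) + H₁ (A - Dt A))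
        = 𝔉 (solA180 𝒢 W 0 H₁ ε₄ (0 - Dt 0) + H₁ (0 - Dt 0)) - φ (H₁ (Dt A)) + q A := by
  obtain ⟨q, hq, h26⟩ := expansion_firstOrder_comp (H₁ := H₁) R hWa hj ha h𝔉 hDt0 hDt
  have hφS := inner_J_eq_zero_of_expansion26 Sc (φ ∘L (H₁.restrictScalars ℝ))
    (f := fun A : 𝒳 => 𝔉 (solA180 𝒢 W 0 H₁ ε₄ (A - Dt A) + H₁ (A - Dt A)))
    (Filter.Eventually.of_forall h26) hDt hq hr hmin
  refine ⟨q, hq, fun A hA => ?_⟩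
  have h19 := linear_term_absent_19 Sc (φ ∘L (H₁.restrictScalars ℝ)) hφS hA
    (f := fun A : 𝒳 => 𝔉 (solA180 𝒢 W 0 H₁ ε₄ (A - Dt A) + H₁ (A - Dt A))) (h26 A)
  simpa using h19

end B11Scheme

/-! ### §6d With the functional (74) of [7]: `𝔉′(0) = ⟨·, J⟩` by name from `B11Eq177FirstOrder` v1.1 -/

section Functional74

open scoped RealInnerProductSpace
open B11Eq81Expansion (functional74)
open B11Eq177FirstOrder (hasFDerivAt_functional74_zero)

variable {E F' : Type*} [NormedAddCommGroup E] [NormedSpace ℝ E] [NormedAddCommGroup F'] [InnerProductSpace ℝ F']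

/-- **STEP k WITH THE FUNCTIONAL (74) OF [7]**: `𝔉 = functional74 A0 J Δ_π HD V₀` — (74) `A(U₀) + ⟨A′ − HD(A′), J⟩ +
½⟨A′ − HD(A′), Δ_π(A′ − HD(A′))⟩ + V₀(A′ − HD(A′))`, the expansion of `A^η(exp(iη(A′ − HD(A′)))U_{k+1})` — has
derivative `⟨·, J⟩` at `0` when `HD` is of second order, `Δ_π` bounded and `V₀` of second order near `0` (r08's
`B11Eq177FirstOrder.hasFDerivAt_functional74_zero`, (78)–(81)); so the minimum of `A ↦ 𝔉(𝒜₁(A − D̃A) + H₁(A − D̃A))`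
at `0` on the constraint space `S` near `0` (`𝒜₁`, `D̃` of second order) gives `⟪H₁v, J⟫ = 0` for all `v ∈ S`.
[cite: Balaban1985UV3, p.268, (53) p.269] [cite: Balaban1985Variational, (74) p.289, (78)-(81) p.290, (176)-(177) p.306] -/
theorem inner_H1_J_eq_zero_functional74 (S : Submodule ℝ E) (H₁ : E →L[ℝ] F') (A0 : ℝ) (J : F')
    (Δπ : F' →L[ℝ] F') {HD : F' → F'} {V₀ : F' → ℝ} {K K₀ ρ : ℝ} (hρ : 0 < ρ) (hK : 0 ≤ K) (hK₀ : 0 ≤ K₀)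
    (hHD : ∀ X : F', ‖X‖ < ρ → ‖HD X‖ ≤ K * ‖X‖ ^ 2) (hV₀ : ∀ X : F', ‖X‖ < ρ → |V₀ X| ≤ K₀ * ‖X‖ ^ 2)
    {𝒜₁ : E → F'} (h𝒜0 : 𝒜₁ 0 = 0) (h𝒜 : HasFDerivAt 𝒜₁ (0 : E →L[ℝ] F') 0) {Dt : E → E} (hDt0 : Dt 0 = 0)
    (hDt : HasFDerivAt Dt (0 : E →L[ℝ] E) 0) {r : ℝ} (hr : 0 < r)
    (hmin : ∀ A ∈ S, ‖A‖ < r →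
      functional74 A0 J (Δπ : F' →ₗ[ℝ] F') HD V₀ (𝒜₁ (0 - Dt 0) + H₁ (0 - Dt 0))
        ≤ functional74 A0 J (Δπ : F' →ₗ[ℝ] F') HD V₀ (𝒜₁ (A - Dt A) + H₁ (A - Dt A))) :
    ∀ v ∈ S, ⟪H₁ v, J⟫ = 0 := by
  intro v hv
  have h := inner_H1_J_eq_zero_stepk S H₁ h𝒜0 h𝒜 hDt0 hDt
    (hasFDerivAt_functional74_zero A0 J Δπ hρ hK hK₀ hHD hV₀) hr hmin v hv
  rw [innerSL_apply_apply] at h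
  rwa [real_inner_comm] at h

end Functional74

/-! ## §7 (v1.3) The «orthogonality relations» of (53) DERIVED: `Orthogonality53` and `Expansion53` from print's cited
inputs and the minimality of `V^{(k)}`

p. 269 [PDF 15]: *«Next using the gauge invariance of the action, the expansion (26), Eq. (174), and the formulas (74),
(78)–(81) of [7], we get»* (53) *«We have used also orthogonality relations following from the definitions of operations and
configurations used above.»*  The located reading `B10SectCExpansion.Orthogonality53` (this seat, gen 1) lists exactly what
the passage from the second to the third member of (53) drops: `⟨H₁A, J⟩`, `⟨𝓗₁, J⟩`, `⟨H₁(A − D̃(A)), Δ₁𝓗₁⟩` (plus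
`Δ₁` symmetric and `D̃ = D̃⁽²⁾ + D̃₃`).  With the identification of the second member — it IS the functional (81) of [7],
`𝔉(A′) = A(U₀) + ⟨A′, J⟩ + ½⟨A′, Δ₁A′⟩ + V(A′)` (`B11Eq127EulerLagrange.functional81`, U₀ = U_{k+1}), at `A′ = H₁(A − D̃A)
+ 𝓗₁(A)` where `𝓗₁(A) = 𝒜₁(A − D̃(A))` is the second-order part of the representation (174) — the three relations FOLLOW:
(i) `⟨H₁A, J⟩ = 0` on the constraint space `S`: §6 (minimality of `V^{(k)}` along the chart (50), Fermat);
(ii) `⟨𝓗₁(A), J⟩ = 0`: `𝒜₁(B)` lies in `T = ker Q ∩ ker RD*` because the solution of (175) lies in the range-closed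
constraint space of `𝔊` ([7] p. 294 «Q𝔊 = 0, RD*𝔊 = 0»; in the Sect. E–G scheme this is
`B11Prop6Scheme.solution_mem_submodule` — `calA1_mem_of_range_le` below), and `J ⟂ T` is (170) of [7] («If we take such
a configuration [the minimal one] as U₀ in the expansion (74), then … ⟨δA′, J⟩ = 0 for δA′: QδA′ = 0, RD*δA′ = 0»), BY
NAME from r08's `B11Eq177FirstOrder.inner_J_eq_zero_of_isLocalMinOn` (the functional (81) locally minimal at `A′ = 0` on
`T` — the minimality of `U_{k+1}` along the chart (47)/(74));
(iii) `⟨H₁(A − D̃A), Δ₁𝓗₁(A)⟩ = ⟨𝓗₁(A), Δ₁H₁(A − D̃A)⟩ = 0` by the symmetry of `Δ₁` and [7] p. 293 «⟨δA′, Δ₁H₁B⟩ = 0»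
for `δA′ ∈ T` (r08's `B11Eq101Translation.inner_delta1_H1_eq_zero`; here the located hypothesis `h293`).
So `Orthogonality53` holds (`orthogonality53_of_minimality`), `Line2_53` is definitional (`line2_53_of_functional81`), and
`expansion53_of_line2` (p238811) gives the THIRD member of (53) (`expansion53_of_minimality`). -/

section Orthogonality53Derived

/-! ### §7a In the Sect. E–G scheme of [7]: `𝒜₁(B) ∈ T` and `⟨𝒜₁(B), J⟩ = 0` -/

section Scheme

open B11Eq174Chart (Regime)
open B11Eq183Differentiation (solA180)
open B11Eq177FirstOrder (solA175_eq)

variable {𝒳 𝒴 𝒵 : Type*} [NormedAddCommGroup 𝒳] [NormedSpace ℂ 𝒳] [NormedAddCommGroup 𝒴] [NormedSpace ℂ 𝒴]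
  [NormedAddCommGroup 𝒵] [NormedSpace ℂ 𝒵] [CompleteSpace 𝒴]
variable {𝒢 : 𝒵 →L[ℂ] 𝒴} {W : 𝒴 → 𝒵} {H₁ : 𝒳 →L[ℂ] 𝒴} {B₀ θ C₄ a₃ j a ε₄ : ℝ}

/-- **`𝒜₁(B) ∈ T`** ([7] p. 294: «the operator G₁𝔓* is equal to the operator 𝔊 … Q𝔊 = 0, RD*𝔊 = 0», so (111)/(175) is
solved inside the constraint space): in the Sect. E–G scheme, for every CLOSED subspace `T` containing the range of `𝔊`, the
selected solution `𝒜₁(B) = solA180 𝔊 ((δ/δA′)V) 0 H₁ ε₄ B` of (175) lies in `T` whenever `‖H₁B‖ < a`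
(`B11Prop6Scheme.solution_mem_submodule` at `Λ = 0`, `J = 0`). [cite: Balaban1985Variational, (111) p.294, (175) p.305]
[cite: Balaban1985UV3, (53) p.269] -/
theorem calA1_mem_of_range_le (R : Regime 𝒢 0 W B₀ θ C₄ a₃ j a ε₄) (hj : 0 ≤ j) (T : Submodule ℂ 𝒴)
    (hT : IsClosed (T : Set 𝒴)) (h𝒢T : ∀ f, 𝒢 f ∈ T) {B : 𝒳} (hB : ‖H₁ B‖ < a) :
    solA180 𝒢 W 0 H₁ ε₄ B ∈ T := by
  rw [solA175_eq]
  have hJ : ‖(0 : 𝒵)‖ ≤ j := by simpa using hj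
  have hm := R.solA_mem hJ hB
  exact B11Prop6Scheme.solution_mem_submodule R.norm_G R.norm_L R.quad R.B₀_nonneg R.C₄_nonneg R.θ_nonneg hJ
    hB R.ε₄_nonneg R.dom R.self R.contr T hT h𝒢T (fun Y => by simp) hm.1 hm.2

/-- **THE SECOND ORTHOGONALITY RELATION OF (53) IN THE SCHEME, `⟨𝓗₁, J⟩ = 0`**: with `𝓗₁(A) = 𝒜₁(A − D̃A)`, a
real-differentiable `𝔉` with derivative `φ` at `0` ((74)/(81), `φ = ⟨·, J⟩`) having a minimum at `A′ = 0` on the closed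
constraint space `T ⊇ range 𝔊` near `0` (the minimality of `U_{k+1}` along the chart (47)/(74); (170) of [7]), one has
`φ(𝒜₁(B)) = 0` whenever `‖H₁B‖ < a` — Fermat along `T` (§1) and `𝒜₁(B) ∈ T`.
[cite: Balaban1985UV3, (53) p.269] [cite: Balaban1985Variational, (170) p.305, (111) p.294, (175) p.305] -/
theorem inner_calA1_J_eq_zero_b11_scheme (R : Regime 𝒢 0 W B₀ θ C₄ a₃ j a ε₄) (hj : 0 ≤ j) (T : Submodule ℂ 𝒴)
    (hT : IsClosed (T : Set 𝒴)) (h𝒢T : ∀ f, 𝒢 f ∈ T) {𝔉 : 𝒴 → ℝ} {φ : 𝒴 →L[ℝ] ℝ} (h𝔉 : HasFDerivAt 𝔉 φ 0)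
    {r : ℝ} (hr : 0 < r) (hminT : ∀ A' ∈ T, ‖A'‖ < r → 𝔉 0 ≤ 𝔉 A') {B : 𝒳} (hB : ‖H₁ B‖ < a) :
    φ (solA180 𝒢 W 0 H₁ ε₄ B) = 0 := by
  have hminT' : ∀ A' ∈ T.restrictScalars ℝ, ‖A'‖ < r → 𝔉 0 ≤ 𝔉 A' :=
    fun A hA hAr => hminT A (by simpa using hA) hAr
  have hφT : ∀ v ∈ T.restrictScalars ℝ, φ v = 0 :=
    fderiv_apply_eq_zero_of_minOn_subspace (T.restrictScalars ℝ) h𝔉 hr hminT'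
  have hmem : solA180 𝒢 W 0 H₁ ε₄ B ∈ T.restrictScalars ℝ := by
    simpa using calA1_mem_of_range_le R hj T hT h𝒢T hB
  exact hφT _ hmem

/-- **THE CROSS TERM OF (53) IN THE SCHEME**: for a symmetric real bilinear pairing `β` on the field space (print: `⟨·, Δ₁·⟩`)
with [7] p. 293's «⟨δA′, Δ₁H₁B′⟩ = 0 for δA′ ∈ T» (`h293`), `β(H₁B′, 𝒜₁(B)) = 0` whenever `‖H₁B‖ < a` — since `𝒜₁(B) ∈ T`.
[cite: Balaban1985UV3, (53) p.269] [cite: Balaban1985Variational, (101) p.293, (111) p.294] -/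
theorem cross_term_eq_zero_b11_scheme (R : Regime 𝒢 0 W B₀ θ C₄ a₃ j a ε₄) (hj : 0 ≤ j) (T : Submodule ℂ 𝒴)
    (hT : IsClosed (T : Set 𝒴)) (h𝒢T : ∀ f, 𝒢 f ∈ T) (β : 𝒴 → 𝒴 → ℝ) (hβ : ∀ x y, β x y = β y x)
    (h293 : ∀ δ ∈ T, ∀ B' : 𝒳, β δ (H₁ B') = 0) {B : 𝒳} (hB : ‖H₁ B‖ < a) (B' : 𝒳) :
    β (H₁ B') (solA180 𝒢 W 0 H₁ ε₄ B) = 0 := by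
  rw [hβ]
  exact h293 _ (calA1_mem_of_range_le R hj T hT h𝒢T hB) B'

end Scheme

/-! ### §7b In the letters of row B10.Eq53 (`B10SectCExpansion.ExpansionData`): `Orthogonality53` and `Expansion53` -/

section Row53Derived

open scoped RealInnerProductSpace
open B10SectCExpansion (ExpansionData Line2_53 Orthogonality53 Expansion53 expansion53_of_line2)
open B11Eq127EulerLagrange (functional81)
open B11Eq81Expansion (hasFDerivAt84)
open B11Eq177FirstOrder (inner_J_eq_zero_of_isLocalMinOn)

variable {F F' : Type*} [NormedAddCommGroup F] [InnerProductSpace ℝ F] [NormedAddCommGroup F']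
  [InnerProductSpace ℝ F']

/-- the functional (81) of [7] has Fréchet derivative `⟨·, J⟩` at `A′ = 0` (its (84)-derivative `⟨·, J⟩ + ⟨·, Δ₁A′⟩ + DV(A′)`
at `A′ = 0` with `V′(0) = 0`, (80): «third and higher order»), for `Δ₁` symmetric and continuous.
[cite: Balaban1985Variational, (81)-(84) p.290] -/
theorem hasFDerivAt_functional81_zero (c : ℝ) (J : F') (Δ₁ : F' →L[ℝ] F')
    (hΔ : ∀ x y, ⟪Δ₁ x, y⟫ = ⟪x, Δ₁ y⟫) {V : F' → ℝ} (hV : HasFDerivAt V (0 : F' →L[ℝ] ℝ) 0) :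
    HasFDerivAt (functional81 c J (Δ₁ : F' →ₗ[ℝ] F') V) (innerSL ℝ J) 0 := by
  have h := hasFDerivAt84 c J Δ₁ hΔ hV
  simp only [map_zero, add_zero] at h
  exact h

/-- **`Line2_53` IS DEFINITIONAL**: if the action along the step-k chart is the functional (81) of [7] at
`A′ = H₁(A − D̃A) + 𝓗₁(A)` — print: «using … the expansion (26), Eq. (174), and the formulas (74), (78)–(81) of [7]» —
then the second member of (53) holds as typed (`B10SectCExpansion.Line2_53`), on any set of fields.
[cite: Balaban1985UV3, (53) p.269] [cite: Balaban1985Variational, (81) p.290, (174) p.305] -/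
theorem line2_53_of_functional81 (d : ExpansionData F F')
    (hact : ∀ A, d.actFl A = functional81 d.actK1 d.J d.Δ₁ d.V (d.H₁ (A - d.D A) + d.ℋ₁ A)) (S' : Set F) :
    Line2_53 d S' := by
  intro A _
  rw [hact A, functional81]

/-- **THE «ORTHOGONALITY RELATIONS» OF (53) DERIVED** — `B10SectCExpansion.Orthogonality53 d S′` is a THEOREM under: `Δ₁`
symmetric and continuous and `V′(0) = 0` ((78)–(81) of [7]); the split `D̃ = D̃⁽²⁾ + D̃₃` (definition of `D̃₃`); the
representation (174) `𝓗₁(A) = 𝒜₁(A − D̃A)` with `𝒜₁` of second order ((176)), `H₁` continuous, `D̃` of second order ((17)/(50));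
the identification `actFl = (81) at H₁(A − D̃A) + 𝓗₁(A)` ((52), (174), (74)–(81)); THE MINIMALITY OF `V^{(k)}` (p. 268) read
along the two charts — `actFl 0 ≤ actFl A` on the constraint space `S` near `0` ((50)) and the functional (81) locally
minimal at `A′ = 0` on `T = ker Q ∩ ker RD*` ((47)/(74); [7] (170)) —; `𝒜₁(B) ∈ T` ([7] p. 294 «Q𝔊 = 0, RD*𝔊 = 0»;
`calA1_mem_of_range_le` in the scheme); and [7] p. 293 «⟨δA′, Δ₁H₁B⟩ = 0 for δA′ ∈ T».  Conjunct (i) is §6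
(`orthogonality53_inner_H1_J`), (ii) is (170) BY NAME from `B11Eq177FirstOrder.inner_J_eq_zero_of_isLocalMinOn`, (iii) is
symmetry + p. 293. [cite: Balaban1985UV3, (53) p.269, p.268]
[cite: Balaban1985Variational, (170) p.305, (174)-(177) p.305-306, (101) p.293, (111) p.294, (78)-(81) p.290] -/
theorem orthogonality53_of_minimality (d : ExpansionData F F') (hsym : d.Δ₁.IsSymmetric) (hΔc : Continuous d.Δ₁)
    (hV : HasFDerivAt d.V (0 : F' →L[ℝ] ℝ) 0) (hD : ∀ A, d.D A = d.D₂ A + d.D₃ A) (hH₁ : Continuous d.H₁)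
    {𝒜₁ : F → F'} (hℋ : ∀ A, d.ℋ₁ A = 𝒜₁ (A - d.D A)) (h𝒜0 : 𝒜₁ 0 = 0)
    (h𝒜 : HasFDerivAt 𝒜₁ (0 : F →L[ℝ] F') 0) (hD0 : d.D 0 = 0) (hDd : HasFDerivAt d.D (0 : F →L[ℝ] F) 0)
    (hact : ∀ A, d.actFl A = functional81 d.actK1 d.J d.Δ₁ d.V (d.H₁ (A - d.D A) + d.ℋ₁ A))
    (S : Submodule ℝ F) {r : ℝ} (hr : 0 < r) (hmin : ∀ A ∈ S, ‖A‖ < r → d.actFl 0 ≤ d.actFl A)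
    (T : Submodule ℝ F') (hminT : IsLocalMinOn (functional81 d.actK1 d.J d.Δ₁ d.V) (T : Set F') 0)
    (h𝒜T : ∀ B, 𝒜₁ B ∈ T) (h293 : ∀ δ ∈ T, ∀ B, ⟪δ, d.Δ₁ (d.H₁ B)⟫ = 0)
    {S' : Set F} (hS' : S' ⊆ (S : Set F)) : Orthogonality53 d S' := by
  -- (81) has derivative `⟨·, J⟩` at `0` (`Δ₁` packaged as a continuous linear map; its coercion back is `d.Δ₁` by `rfl`)
  have h𝔉 : HasFDerivAt (functional81 d.actK1 d.J d.Δ₁ d.V) (innerSL ℝ d.J) 0 :=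
    hasFDerivAt_functional81_zero d.actK1 d.J ⟨d.Δ₁, hΔc⟩ (fun x y => hsym x y) hV
  -- the action along the chart in the shape of §6b
  have hact' : ∀ A, d.actFl A
      = functional81 d.actK1 d.J d.Δ₁ d.V (𝒜₁ (A - d.D A) + d.H₁ (A - d.D A)) := by
    intro A; rw [hact A, hℋ A, add_comm]
  -- (170): `J ⟂ T`
  have hJT : ∀ δ ∈ T, ⟪δ, d.J⟫ = 0 :=
    inner_J_eq_zero_of_isLocalMinOn (c := d.actK1) (fun x y => hsym x y) hV T hminT
  refine ⟨hsym, fun A hA => ⟨hD A, ?_, ?_, ?_⟩⟩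
  · -- (i) `⟨H₁A, J⟩ = 0`: §6
    exact orthogonality53_inner_H1_J d hH₁ h𝔉 h𝒜0 h𝒜 hD0 hDd hact' S hr hmin A (hS' hA)
  · -- (ii) `⟨𝓗₁(A), J⟩ = 0`: `𝓗₁(A) = 𝒜₁(A − D̃A) ∈ T` and (170)
    have hT : d.ℋ₁ A ∈ T := by rw [hℋ A]; exact h𝒜T _
    exact hJT _ hT
  · -- (iii) the cross term: symmetry of `Δ₁` and p. 293
    have hT : d.ℋ₁ A ∈ T := by rw [hℋ A]; exact h𝒜T _
    calc ⟪d.H₁ (A - d.D A), d.Δ₁ (d.ℋ₁ A)⟫ = ⟪d.Δ₁ (d.H₁ (A - d.D A)), d.ℋ₁ A⟫ := (hsym _ _).symm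
      _ = ⟪d.ℋ₁ A, d.Δ₁ (d.H₁ (A - d.D A))⟫ := real_inner_comm _ _
      _ = 0 := h293 _ hT _

/-- **(53), THIRD MEMBER, FROM PRINT'S CITED INPUTS AND THE MINIMALITY OF `V^{(k)}`**: under the hypotheses of
`orthogonality53_of_minimality`, `B10SectCExpansion.Expansion53 d S′` — «A^η(U_k(exp i(A − D̃(A))V_k^{(k)})) = A^η(U_{k+1}) +
½⟨H₁A, Δ₁H₁A⟩ − ⟨H₁D̃⁽²⁾(A), J⟩ + {⋯}» — holds for every `S′ ⊆ S` (the second member being the functional (81) at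
`H₁(A − D̃A) + 𝓗₁(A)`, `line2_53_of_functional81`, and the regrouping `expansion53_of_line2` of p238811).
[cite: Balaban1985UV3, (53) p.269] [cite: Balaban1985Variational, (81) p.290, (170) p.305, (174)-(177) p.305-306] -/
theorem expansion53_of_minimality (d : ExpansionData F F') (hsym : d.Δ₁.IsSymmetric) (hΔc : Continuous d.Δ₁)
    (hV : HasFDerivAt d.V (0 : F' →L[ℝ] ℝ) 0) (hD : ∀ A, d.D A = d.D₂ A + d.D₃ A) (hH₁ : Continuous d.H₁)
    {𝒜₁ : F → F'} (hℋ : ∀ A, d.ℋ₁ A = 𝒜₁ (A - d.D A)) (h𝒜0 : 𝒜₁ 0 = 0)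
    (h𝒜 : HasFDerivAt 𝒜₁ (0 : F →L[ℝ] F') 0) (hD0 : d.D 0 = 0) (hDd : HasFDerivAt d.D (0 : F →L[ℝ] F) 0)
    (hact : ∀ A, d.actFl A = functional81 d.actK1 d.J d.Δ₁ d.V (d.H₁ (A - d.D A) + d.ℋ₁ A))
    (S : Submodule ℝ F) {r : ℝ} (hr : 0 < r) (hmin : ∀ A ∈ S, ‖A‖ < r → d.actFl 0 ≤ d.actFl A)
    (T : Submodule ℝ F') (hminT : IsLocalMinOn (functional81 d.actK1 d.J d.Δ₁ d.V) (T : Set F') 0)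
    (h𝒜T : ∀ B, 𝒜₁ B ∈ T) (h293 : ∀ δ ∈ T, ∀ B, ⟪δ, d.Δ₁ (d.H₁ B)⟫ = 0)
    {S' : Set F} (hS' : S' ⊆ (S : Set F)) : Expansion53 d S' :=
  expansion53_of_line2 d S' (line2_53_of_functional81 d hact S')
    (orthogonality53_of_minimality d hsym hΔc hV hD hH₁ hℋ h𝒜0 h𝒜 hD0 hDd hact S hr hmin T hminT h𝒜T h293 hS')

end Row53Derived

end Orthogonality53Derived

/-! ## §8 (v1.4) The same in [7]'s own operator letters: the located inputs of §7 BY NAME from the B11 block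

The two located hypotheses of `orthogonality53_of_minimality` — `h𝒜T : 𝒜₁(B) ∈ T` (p. 294) and `h293 : ⟨δA′, Δ₁H₁B⟩ = 0` on
`T` (p. 293) — are theorems of the B11 block in [7]'s operator letters (`B11Eq177FirstOrder` v1.3 §7, seat r08, p313597): with
`T = {δA′ : QδA′ = 0, RD*δA′ = 0}` (`B11Eq81Expansion.tangent83`, (83)/(100)/(109)), the non-linear part `𝒜₁(B)` of the
representative (174) solves (175) `𝒜₁ + 𝔊((δ/δA′)V)(𝒜₁ + H₁B) = 0` and «Q𝔊 = 0, RD*𝔊 = 0» (p. 294), so `𝒜₁(B) ∈ T`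
(`solution175_mem_tangent`) and `⟨𝒜₁(B), J⟩ = 0` by (170) (`inner_solution175_J_eq_zero`); and for `H₁B = G₁Q*(QG₁Q*)⁻¹B`
((45)/(129), `B11Eq129Minimizer.hOp`) with `Δ_{1,a}G₁ = 1`, `⟨x, Q*y⟩ = ⟨Qx, y⟩`, `RD*H₁B = 0`, the identity «⟨δA′, Δ₁H₁B⟩ = 0»
of p. 293 holds for `QδA′ = 0` (`B11Eq101Translation.inner_delta1_H1_eq_zero`), whence the cross term
(`inner_hOp_delta1_eq_zero`).  (170) itself comes from the minimality of `U_{k+1}` along the (47)/(74) chart (`eq170`). -/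

section B11Operators

open scoped RealInnerProductSpace
open B10SectCExpansion (ExpansionData Orthogonality53 Expansion53 expansion53_of_line2)
open B11Eq127EulerLagrange (functional81 laplaceA)
open B11Eq129Minimizer (hOp)
open B11Eq81Expansion (tangent83)
open B11Eq177FirstOrder (eq170 inner_solution175_J_eq_zero solution175_mem_tangent inner_hOp_delta1_eq_zero)

variable {F F' : Type*} [NormedAddCommGroup F] [InnerProductSpace ℝ F] [NormedAddCommGroup F']
  [InnerProductSpace ℝ F']
variable {Sg : Type*} [AddCommGroup Sg] [Module ℝ Sg] {Z : Type*} [AddCommGroup Z] [Module ℝ Z]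

/-- **THE «ORTHOGONALITY RELATIONS» OF (53) IN [7]'s OPERATOR LETTERS** — `Orthogonality53 d S′` with EVERY located relation
supplied by a B11 theorem: `T = tangent83 Q R D*`; (i) `⟨H₁A, J⟩ = 0` = §6 (minimality of `V^{(k)}` along the (50)-chart on
`S`); (ii) `⟨𝓗₁(A), J⟩ = 0` = `inner_solution175_J_eq_zero` from (175) `𝒜₁(B) + 𝔊(w(B)) = 0`, «Q𝔊 = 0, RD*𝔊 = 0» (p. 294)
and (170) = `eq170` (the functional (81) locally minimal at `A′ = 0` on `T`); (iii) the cross term = `inner_hOp_delta1_eq_zero`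
from `H₁ = G₁Q*(QG₁Q*)⁻¹` (`hOp`), `Δ_{1,a}G₁ = 1`, `⟨x, Q*y⟩ = ⟨Qx, y⟩`, `RD*H₁ = 0` and `Q(𝓗₁(A)) = 0`
(`solution175_mem_tangent`).  Remaining hypotheses: these identifications/identities of [7] (in B11's letters, as in r08's
files), `Δ₁` symmetric and continuous, `V′(0) = 0`, the split `D̃ = D̃⁽²⁾ + D̃₃`, `𝒜₁`/`D̃` of second order, `H₁` continuous,
`hact` ((81) at the (174) argument) and the minimality of `V^{(k)}` along the two charts (`hmin`, `hminT`).
[cite: Balaban1985UV3, (53) p.269, p.268] [cite: Balaban1985Variational, (170) p.305, (175) p.305, (109)-(111) p.294,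
(101) p.293, (45) p.285, (129) p.297, (83) p.290] -/
theorem orthogonality53_of_minimality_b11ops (d : ExpansionData F F') (hsym : d.Δ₁.IsSymmetric)
    (hΔc : Continuous d.Δ₁) (hV : HasFDerivAt d.V (0 : F' →L[ℝ] ℝ) 0) (hD : ∀ A, d.D A = d.D₂ A + d.D₃ A)
    (hH₁ : Continuous d.H₁) {𝒜₁ : F → F'} (hℋ : ∀ A, d.ℋ₁ A = 𝒜₁ (A - d.D A)) (h𝒜0 : 𝒜₁ 0 = 0)
    (h𝒜 : HasFDerivAt 𝒜₁ (0 : F →L[ℝ] F') 0) (hD0 : d.D 0 = 0) (hDd : HasFDerivAt d.D (0 : F →L[ℝ] F) 0)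
    (hact : ∀ A, d.actFl A = functional81 d.actK1 d.J d.Δ₁ d.V (d.H₁ (A - d.D A) + d.ℋ₁ A))
    (S : Submodule ℝ F) {r : ℝ} (hr : 0 < r) (hmin : ∀ A ∈ S, ‖A‖ < r → d.actFl 0 ≤ d.actFl A)
    -- [7]'s operators: averaging `Q` (12), gauge data `R`, `D*` (tangent space (83)/(109)), `𝔊` (111), `H₁ = G₁Q*(QG₁Q*)⁻¹` (45)
    (Q : F' →ₗ[ℝ] F) (R : Sg →ₗ[ℝ] Sg) (Dstar : F' →ₗ[ℝ] Sg)
    (hminT : IsLocalMinOn (functional81 d.actK1 d.J d.Δ₁ d.V) (tangent83 Q R Dstar : Set F') 0)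
    {𝔊 : Z →ₗ[ℝ] F'} (hQ𝔊 : ∀ z, Q (𝔊 z) = 0) (hR𝔊 : ∀ z, R (Dstar (𝔊 z)) = 0)
    {w : F → Z} (h175 : ∀ B, 𝒜₁ B + 𝔊 (w B) = 0)
    {G₁ : F' →ₗ[ℝ] F'} {Qadj : F →ₗ[ℝ] F'} {Kinv : F →ₗ[ℝ] F} (Dop : Sg →ₗ[ℝ] F') (a : ℝ)
    (hH₁op : ∀ B, d.H₁ B = hOp G₁ Qadj Kinv B) (hadj : ∀ (x : F') (y : F), ⟪x, Qadj y⟫ = ⟪Q x, y⟫)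
    (hΔG : ∀ x : F', laplaceA d.Δ₁ Dop R Dstar Q Qadj a (G₁ x) = x)
    (hRD : ∀ b : F, R (Dstar (hOp G₁ Qadj Kinv b)) = 0)
    {S' : Set F} (hS' : S' ⊆ (S : Set F)) : Orthogonality53 d S' := by
  have hsym' : ∀ x y, ⟪d.Δ₁ x, y⟫ = ⟪x, d.Δ₁ y⟫ := fun x y => hsym x y
  have h𝔉 : HasFDerivAt (functional81 d.actK1 d.J d.Δ₁ d.V) (innerSL ℝ d.J) 0 :=
    hasFDerivAt_functional81_zero d.actK1 d.J ⟨d.Δ₁, hΔc⟩ hsym' hV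
  have hact' : ∀ A, d.actFl A
      = functional81 d.actK1 d.J d.Δ₁ d.V (𝒜₁ (A - d.D A) + d.H₁ (A - d.D A)) := by
    intro A; rw [hact A, hℋ A, add_comm]
  -- (170) from the minimality on `T = tangent83 Q R D*`
  have h170 : ∀ δ : F', Q δ = 0 → R (Dstar δ) = 0 → ⟪δ, d.J⟫ = 0 :=
    eq170 (c := d.actK1) hsym' hV Q R Dstar hminT
  refine ⟨hsym, fun A hA => ⟨hD A, ?_, ?_, ?_⟩⟩
  · -- (i) §6
    exact orthogonality53_inner_H1_J d hH₁ h𝔉 h𝒜0 h𝒜 hD0 hDd hact' S hr hmin A (hS' hA)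
  · -- (ii) (175) + p. 294 + (170), by name
    rw [hℋ A]
    exact inner_solution175_J_eq_zero Q R Dstar h170 hQ𝔊 hR𝔊 (h175 (A - d.D A))
  · -- (iii) p. 293 in operator letters, by name
    have hQX : Q (d.ℋ₁ A) = 0 := by
      rw [hℋ A]; exact (solution175_mem_tangent Q R Dstar hQ𝔊 hR𝔊 (h175 (A - d.D A))).1
    rw [hH₁op]
    exact inner_hOp_delta1_eq_zero Dop R Dstar a hsym' hadj hΔG hRD hQX (A - d.D A)

/-- **(53), THIRD MEMBER, IN [7]'s OPERATOR LETTERS**: under the hypotheses of `orthogonality53_of_minimality_b11ops`,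
`Expansion53 d S′` (via `line2_53_of_functional81` and `expansion53_of_line2`). [cite: Balaban1985UV3, (53) p.269]
[cite: Balaban1985Variational, (170) p.305, (174)-(177) p.305-306, (101) p.293, (109)-(111) p.294] -/
theorem expansion53_of_minimality_b11ops (d : ExpansionData F F') (hsym : d.Δ₁.IsSymmetric)
    (hΔc : Continuous d.Δ₁) (hV : HasFDerivAt d.V (0 : F' →L[ℝ] ℝ) 0) (hD : ∀ A, d.D A = d.D₂ A + d.D₃ A)
    (hH₁ : Continuous d.H₁) {𝒜₁ : F → F'} (hℋ : ∀ A, d.ℋ₁ A = 𝒜₁ (A - d.D A)) (h𝒜0 : 𝒜₁ 0 = 0)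
    (h𝒜 : HasFDerivAt 𝒜₁ (0 : F →L[ℝ] F') 0) (hD0 : d.D 0 = 0) (hDd : HasFDerivAt d.D (0 : F →L[ℝ] F) 0)
    (hact : ∀ A, d.actFl A = functional81 d.actK1 d.J d.Δ₁ d.V (d.H₁ (A - d.D A) + d.ℋ₁ A))
    (S : Submodule ℝ F) {r : ℝ} (hr : 0 < r) (hmin : ∀ A ∈ S, ‖A‖ < r → d.actFl 0 ≤ d.actFl A)
    (Q : F' →ₗ[ℝ] F) (R : Sg →ₗ[ℝ] Sg) (Dstar : F' →ₗ[ℝ] Sg)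
    (hminT : IsLocalMinOn (functional81 d.actK1 d.J d.Δ₁ d.V) (tangent83 Q R Dstar : Set F') 0)
    {𝔊 : Z →ₗ[ℝ] F'} (hQ𝔊 : ∀ z, Q (𝔊 z) = 0) (hR𝔊 : ∀ z, R (Dstar (𝔊 z)) = 0)
    {w : F → Z} (h175 : ∀ B, 𝒜₁ B + 𝔊 (w B) = 0)
    {G₁ : F' →ₗ[ℝ] F'} {Qadj : F →ₗ[ℝ] F'} {Kinv : F →ₗ[ℝ] F} (Dop : Sg →ₗ[ℝ] F') (a : ℝ)
    (hH₁op : ∀ B, d.H₁ B = hOp G₁ Qadj Kinv B) (hadj : ∀ (x : F') (y : F), ⟪x, Qadj y⟫ = ⟪Q x, y⟫)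
    (hΔG : ∀ x : F', laplaceA d.Δ₁ Dop R Dstar Q Qadj a (G₁ x) = x)
    (hRD : ∀ b : F, R (Dstar (hOp G₁ Qadj Kinv b)) = 0)
    {S' : Set F} (hS' : S' ⊆ (S : Set F)) : Expansion53 d S' :=
  expansion53_of_line2 d S' (line2_53_of_functional81 d hact S')
    (orthogonality53_of_minimality_b11ops d hsym hΔc hV hD hH₁ hℋ h𝒜0 h𝒜 hD0 hDd hact S hr hmin Q R Dstar hminT
      hQ𝔊 hR𝔊 h175 Dop a hH₁op hadj hΔG hRD hS')

end B11Operators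

/-! ## §9 (v1.5) §5 AT EVERY DIMENSION — in particular at `d = 3`, the dimension of this paper: the (26) inputs BY NAME
from `B11Eq26ExpansionZpow` on the integer-power action `actionZ`

HONEST SCOPE (v) of v1.1–v1.4 recorded that §5 is the `4 ≦ d` instance of the carrier (the natural-number weight `η^{d−4}`
of `B9Eq39Adjoint.action`), whereas this paper works at `d = 3` — (5) p. 256 «A^η(U_k(U)) = Σ_{p⊂T_η} η⁻¹[1 − Re tr
U_k(U)(∂p)]», weight `η^{d−4} = η⁻¹`.  The B9/B11 owners have since typed the `d`-free carrier: `B9Eq31ActionZpow.actionZ`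
(seat r06, p342252: the weight as the INTEGER power `(η:ℂ)^((d:ℤ)−4)`, `= η⁻¹` at `d = 3` by `actionZ_three`, `= action`
for `4 ≦ d` by `actionZ_eq_action`) and `B11Eq26ExpansionZpow.expansion26_real_zpow` (seat r08, p343405: (26)–(28) of [7]
on `actionZ` for every `d`, token for token `B11Eq26FirstVariation.expansion26_real` with `action ↦ actionZ` and the binder
`4 ≦ d` dropped).  This section is §5 with exactly that substitution (recipe `lit-balaban-r08/INTERFACES-r08.md` §AG):
the four theorems of §5 on `actionZ` for every `d : ℕ` (`…_zpow`), the `d = 3` instance with the printed weight `η⁻¹`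
((5) p. 256, (18)–(19) p. 260–261), and the remark that for `4 ≦ d` the §5 theorem is recovered (`actionZ_eq_action`).
Nothing of §1–§8 is modified; `bondPair`/`J` are `d`-free already. -/

section B11CarrierZ

open B9Eq39Adjoint B11Eq26FirstVariation
open B9Eq31ActionZpow (actionZ actionZ_eq_action actionZ_three)
open B11Eq26ExpansionZpow (expansion26_real_zpow)

variable {𝔸 : Type*} [NormedRing 𝔸] [NormedAlgebra ℂ 𝔸] [CompleteSpace 𝔸]
variable {S : Type*} [Fintype S] {ι : Type*} [Fintype ι] [LinearOrder ι]
variable (T : ι → Equiv.Perm S) (U : ι → S → 𝔸ˣ)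

/-- **THE REAL FERMAT CONCLUSION ON THE CARRIER, EVERY `d`** (any background `U₁`, any tracial `τ`): if
`f(A) = Re A^η(exp iη(A − D̃A)·U₁)` — the action with the printed weight `η^{d−4}` as an integer power (`actionZ`),
`D̃(0) = 0`, `D̃′(0) = 0` as in (17) — has a minimum at `A = 0` on the constraint subspace `S` near `0`, then
`Re⟨v, J⟩ = 0` for every `v ∈ S`.  (= `re_inner_J_eq_zero_b11` with `action ↦ actionZ`, `4 ≦ d` dropped; (26) by name
from `expansion26_real_zpow`.) [cite: Balaban1985UV3, p.260 (before (19)), (5) p.256]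
[cite: Balaban1985Variational, (26)-(27) p.282] -/
theorem re_inner_J_eq_zero_b11_zpow (τ : 𝔸 →L[ℂ] ℂ) (hτ : ∀ a b : 𝔸, τ (a * b) = τ (b * a)) (η : ℝ) (hη : η ≠ 0)
    (d : ℕ) {Dt : (ι → S → 𝔸) → (ι → S → 𝔸)} (hDt0 : Dt 0 = 0)
    (hDt : HasFDerivAt Dt (0 : (ι → S → 𝔸) →L[ℝ] (ι → S → 𝔸)) 0)
    (Sc : Submodule ℝ (ι → S → 𝔸)) {r : ℝ} (hr : 0 < r)
    (hmin : ∀ A ∈ Sc, ‖A‖ < r →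
      (actionZ T η d (τ : 𝔸 →ₗ[ℂ] ℂ) (prodCfg U η (0 - Dt 0))).re
        ≤ (actionZ T η d (τ : 𝔸 →ₗ[ℂ] ℂ) (prodCfg U η (A - Dt A))).re) :
    ∀ v ∈ Sc, (bondPair η d (τ : 𝔸 →ₗ[ℂ] ℂ) v (J T U η)).re = 0 := by
  obtain ⟨φ, q, hφ, hq, h26⟩ := expansion26_real_zpow T U τ hτ η hη d hDt0 hDt
  have hφS := inner_J_eq_zero_of_expansion26 Sc φ
    (f := fun A => (actionZ T η d (τ : 𝔸 →ₗ[ℂ] ℂ) (prodCfg U η (A - Dt A))).re)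
    (Filter.Eventually.of_forall h26) hDt hq hr hmin
  intro v hv
  rw [← hφ v]
  exact hφS v hv

/-- **THE PRINTED SHAPE OF (19) ON THE CARRIER, EVERY `d`**: under the same minimum, for `A` in the constraint space
`Re A^η(exp iη(A − D̃A)·U₁) = Re A^η(U₁) − Re⟨D̃A, J⟩ + q(A)` with `q′(0) = 0` — «A(U₁) − ⟨D̃(A), J⟩ + ½⟨A − D̃(A),
Δ(U₁)(A − D̃(A))⟩ + V₀(A − D̃(A))», no `⟨A, J⟩` term.  (= `expansion19_b11` with `action ↦ actionZ`, `4 ≦ d` dropped.)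
[cite: Balaban1985UV3, (19) p.261, (5) p.256] [cite: Balaban1985Variational, (26)-(27) p.282] -/
theorem expansion19_b11_zpow (τ : 𝔸 →L[ℂ] ℂ) (hτ : ∀ a b : 𝔸, τ (a * b) = τ (b * a)) (η : ℝ) (hη : η ≠ 0)
    (d : ℕ) {Dt : (ι → S → 𝔸) → (ι → S → 𝔸)} (hDt0 : Dt 0 = 0)
    (hDt : HasFDerivAt Dt (0 : (ι → S → 𝔸) →L[ℝ] (ι → S → 𝔸)) 0)
    (Sc : Submodule ℝ (ι → S → 𝔸)) {r : ℝ} (hr : 0 < r)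
    (hmin : ∀ A ∈ Sc, ‖A‖ < r →
      (actionZ T η d (τ : 𝔸 →ₗ[ℂ] ℂ) (prodCfg U η (0 - Dt 0))).re
        ≤ (actionZ T η d (τ : 𝔸 →ₗ[ℂ] ℂ) (prodCfg U η (A - Dt A))).re) :
    ∃ q : (ι → S → 𝔸) → ℝ, HasFDerivAt q (0 : (ι → S → 𝔸) →L[ℝ] ℝ) 0 ∧
      ∀ A ∈ Sc, (actionZ T η d (τ : 𝔸 →ₗ[ℂ] ℂ) (prodCfg U η (A - Dt A))).re
        = (actionZ T η d (τ : 𝔸 →ₗ[ℂ] ℂ) U).re - (bondPair η d (τ : 𝔸 →ₗ[ℂ] ℂ) (Dt A) (J T U η)).re + q A := by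
  obtain ⟨φ, q, hφ, hq, h26⟩ := expansion26_real_zpow T U τ hτ η hη d hDt0 hDt
  have hφS := inner_J_eq_zero_of_expansion26 Sc φ
    (f := fun A => (actionZ T η d (τ : 𝔸 →ₗ[ℂ] ℂ) (prodCfg U η (A - Dt A))).re)
    (Filter.Eventually.of_forall h26) hDt hq hr hmin
  refine ⟨q, hq, fun A hA => ?_⟩
  have h19 := linear_term_absent_19 Sc φ hφS hA
    (f := fun A => (actionZ T η d (τ : 𝔸 →ₗ[ℂ] ℂ) (prodCfg U η (A - Dt A))).re) (h26 A)
  rw [hDt0, sub_zero, B9Eq369Product.prodCfg_zero, hφ (Dt A)] at h19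
  exact h19

/-- **FOR `4 ≦ d` THE EVERY-`d` THEOREM IS §5's**: there `actionZ = action` (`B9Eq31ActionZpow.actionZ_eq_action`), so the
minimum hypothesis of `re_inner_J_eq_zero_b11` (on `action`) is the minimum hypothesis of `re_inner_J_eq_zero_b11_zpow`
(on `actionZ`) and the conclusions coincide — a second proof of the v1.1 theorem through §9, recording that §5 is the
`4 ≦ d` instance. [cite: Balaban1985UV3, p.260 (before (19))] [cite: Balaban1985BackgroundPropagators, (3.1) p.390] -/
theorem re_inner_J_eq_zero_b11_of_four_le (τ : 𝔸 →L[ℂ] ℂ) (hτ : ∀ a b : 𝔸, τ (a * b) = τ (b * a)) (η : ℝ)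
    (hη : η ≠ 0) {d : ℕ} (hd : 4 ≤ d) {Dt : (ι → S → 𝔸) → (ι → S → 𝔸)} (hDt0 : Dt 0 = 0)
    (hDt : HasFDerivAt Dt (0 : (ι → S → 𝔸) →L[ℝ] (ι → S → 𝔸)) 0)
    (Sc : Submodule ℝ (ι → S → 𝔸)) {r : ℝ} (hr : 0 < r)
    (hmin : ∀ A ∈ Sc, ‖A‖ < r →
      (action T η d (τ : 𝔸 →ₗ[ℂ] ℂ) (prodCfg U η (0 - Dt 0))).re
        ≤ (action T η d (τ : 𝔸 →ₗ[ℂ] ℂ) (prodCfg U η (A - Dt A))).re) :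
    ∀ v ∈ Sc, (bondPair η d (τ : 𝔸 →ₗ[ℂ] ℂ) v (J T U η)).re = 0 := by
  refine re_inner_J_eq_zero_b11_zpow T U τ hτ η hη d hDt0 hDt Sc hr ?_
  intro A hA hAr
  simpa only [actionZ_eq_action T η hd] using hmin A hA hAr

section Hermitian

variable [StarRing 𝔸] [StarModule ℂ 𝔸]

/-- **p. 260 ⇒ (19), END TO END MODULO THE MINIMUM, EVERY `d`**: over a UNITARY background (`U₁(b)⁻¹ = U₁(b)*`), with a
tracial `*`-compatible `τ` and a real constraint subspace `S` of HERMITIAN bond fields, the minimum at `A = 0` of `A ↦ Re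
A^η(exp iη(A − D̃A)·U₁)` (`actionZ`; `D̃(0) = 0`, `D̃′(0) = 0`) on `S` near `0` gives `⟨v, J⟩ = 0` for every `v ∈ S` — the
linear term of (26) is absent from (19).  (= `inner_J_eq_zero_b11` with `action ↦ actionZ`, `4 ≦ d` dropped; (27)–(28)
«from hermiticity» = r08's `d`-free `bondPair_J_eq_zero_on`.) [cite: Balaban1985UV3, p.260 (before (19)), (19) p.261,
(5) p.256] [cite: Balaban1985Variational, (26)-(28) p.282] -/
theorem inner_J_eq_zero_b11_zpow (hU : ∀ μ x, (((U μ x)⁻¹ : 𝔸ˣ) : 𝔸) = star (U μ x : 𝔸)) (τ : 𝔸 →L[ℂ] ℂ)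
    (hτ : ∀ a b : 𝔸, τ (a * b) = τ (b * a)) (hτs : ∀ a : 𝔸, τ (star a) = starRingEnd ℂ (τ a)) (η : ℝ)
    (hη : η ≠ 0) (d : ℕ) {Dt : (ι → S → 𝔸) → (ι → S → 𝔸)} (hDt0 : Dt 0 = 0)
    (hDt : HasFDerivAt Dt (0 : (ι → S → 𝔸) →L[ℝ] (ι → S → 𝔸)) 0)
    (Sc : Submodule ℝ (ι → S → 𝔸)) (hS : ∀ v ∈ Sc, ∀ μ x, star (v μ x) = v μ x) {r : ℝ} (hr : 0 < r)
    (hmin : ∀ A ∈ Sc, ‖A‖ < r →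
      (actionZ T η d (τ : 𝔸 →ₗ[ℂ] ℂ) (prodCfg U η (0 - Dt 0))).re
        ≤ (actionZ T η d (τ : 𝔸 →ₗ[ℂ] ℂ) (prodCfg U η (A - Dt A))).re) :
    ∀ v ∈ Sc, bondPair η d (τ : 𝔸 →ₗ[ℂ] ℂ) v (J T U η) = 0 :=
  bondPair_J_eq_zero_on T U hU (τ : 𝔸 →ₗ[ℂ] ℂ) hτ hτs η d Sc hS
    (re_inner_J_eq_zero_b11_zpow T U τ hτ η hη d hDt0 hDt Sc hr hmin)

/-- **AT `d = 3`, THE DIMENSION OF THIS PAPER**: with the action of (5) p. 256, «A^η(U) = Σ_{p⊂T_η} η⁻¹[1 − Re tr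
U(∂p)]» — the carrier's `actionZ T η 3`, whose weight IS `η⁻¹` (`B9Eq31ActionZpow.actionZ_three`) —, the minimum at
`A = 0` of the function in the exponential of (18) on the constraint space of Hermitian fields gives `⟨v, J⟩ = 0` on it:
the linear term `⟨A, J⟩` is absent from (19), as printed, at `d = 3`.  (The instance `d = 3` of `inner_J_eq_zero_b11_zpow`;
up to v1.4 only `4 ≦ d` was available, HONEST SCOPE (v).) [cite: Balaban1985UV3, (5) p.256, (18) p.260, (19) p.261]
[cite: Balaban1985Variational, (26)-(28) p.282] -/
theorem inner_J_eq_zero_b11_three (hU : ∀ μ x, (((U μ x)⁻¹ : 𝔸ˣ) : 𝔸) = star (U μ x : 𝔸)) (τ : 𝔸 →L[ℂ] ℂ)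
    (hτ : ∀ a b : 𝔸, τ (a * b) = τ (b * a)) (hτs : ∀ a : 𝔸, τ (star a) = starRingEnd ℂ (τ a)) (η : ℝ)
    (hη : η ≠ 0) {Dt : (ι → S → 𝔸) → (ι → S → 𝔸)} (hDt0 : Dt 0 = 0)
    (hDt : HasFDerivAt Dt (0 : (ι → S → 𝔸) →L[ℝ] (ι → S → 𝔸)) 0)
    (Sc : Submodule ℝ (ι → S → 𝔸)) (hS : ∀ v ∈ Sc, ∀ μ x, star (v μ x) = v μ x) {r : ℝ} (hr : 0 < r)
    (hmin : ∀ A ∈ Sc, ‖A‖ < r →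
      (actionZ T η 3 (τ : 𝔸 →ₗ[ℂ] ℂ) (prodCfg U η (0 - Dt 0))).re
        ≤ (actionZ T η 3 (τ : 𝔸 →ₗ[ℂ] ℂ) (prodCfg U η (A - Dt A))).re) :
    ∀ v ∈ Sc, bondPair η 3 (τ : 𝔸 →ₗ[ℂ] ℂ) v (J T U η) = 0 :=
  inner_J_eq_zero_b11_zpow T U hU τ hτ hτs η hη 3 hDt0 hDt Sc hS hr hmin

open Literature.MathematicalPhysics.QuantumFieldTheory.Balaban1983to89.Beta.TransportVertices
open Literature.MathematicalPhysics.QuantumFieldTheory.Balaban1983to89.B9Eq37Insertion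

/-- **THE SAME WITH THE `d = 3` WEIGHT DISPLAYED**: the hypothesis written with the sum of (5) p. 256, `Σ_p η⁻¹·[1 − Re tr
U(∂p)]` in the complexified reading `wil τ` of the carrier (`actionZ_three`), verbatim. [cite: Balaban1985UV3, (5) p.256,
(19) p.261] [cite: Balaban1985BackgroundPropagators, (3.1) p.390] -/
theorem inner_J_eq_zero_b11_three_printed (hU : ∀ μ x, (((U μ x)⁻¹ : 𝔸ˣ) : 𝔸) = star (U μ x : 𝔸))
    (τ : 𝔸 →L[ℂ] ℂ) (hτ : ∀ a b : 𝔸, τ (a * b) = τ (b * a)) (hτs : ∀ a : 𝔸, τ (star a) = starRingEnd ℂ (τ a))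
    (η : ℝ) (hη : η ≠ 0) {Dt : (ι → S → 𝔸) → (ι → S → 𝔸)} (hDt0 : Dt 0 = 0)
    (hDt : HasFDerivAt Dt (0 : (ι → S → 𝔸) →L[ℝ] (ι → S → 𝔸)) 0)
    (Sc : Submodule ℝ (ι → S → 𝔸)) (hS : ∀ v ∈ Sc, ∀ μ x, star (v μ x) = v μ x) {r : ℝ} (hr : 0 < r)
    (hmin : ∀ A ∈ Sc, ‖A‖ < r →
      (∑ q ∈ posPlaq S ι, ((η : ℂ)⁻¹) * wil (τ : 𝔸 →ₗ[ℂ] ℂ) (plaqU T (prodCfg U η (0 - Dt 0)) q.2.1 q.2.2 q.1)).re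
        ≤ (∑ q ∈ posPlaq S ι, ((η : ℂ)⁻¹) * wil (τ : 𝔸 →ₗ[ℂ] ℂ) (plaqU T (prodCfg U η (A - Dt A)) q.2.1 q.2.2 q.1)).re) :
    ∀ v ∈ Sc, bondPair η 3 (τ : 𝔸 →ₗ[ℂ] ℂ) v (J T U η) = 0 := by
  refine inner_J_eq_zero_b11_three T U hU τ hτ hτs η hη hDt0 hDt Sc hS hr ?_
  intro A hA hAr
  simpa only [actionZ_three] using hmin A hA hAr

open B13PkLocalTerms (hOp)
open B10Eq17LocalSolution

/-- **THE SAME WITH THE TREE'S (17), EVERY `d`**: `D̃` = the support operator `h` of p. 260 applied to the `Eq17Local ℝ`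
solution `Dt` of (17), read in the carrier's coordinates through continuous linear identifications `e`, `e′`; `D̃(0) = 0`
and `D̃′(0) = 0` from `Eq17Local`, so the minimum on `S` alone gives `⟨v, J⟩ = 0` on `S`.  (= `inner_J_eq_zero_b11_of_eq17Local`
with `action ↦ actionZ`, `4 ≦ d` dropped.) [cite: Balaban1985UV3, (17) p.260, (19) p.261, (5) p.256]
[cite: Balaban1985Variational, (26)-(28) p.282] -/
theorem inner_J_eq_zero_b11_of_eq17Local_zpow (hU : ∀ μ x, (((U μ x)⁻¹ : 𝔸ˣ) : 𝔸) = star (U μ x : 𝔸))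
    (τ : 𝔸 →L[ℂ] ℂ) (hτ : ∀ a b : 𝔸, τ (a * b) = τ (b * a)) (hτs : ∀ a : 𝔸, τ (star a) = starRingEnd ℂ (τ a))
    (η : ℝ) (hη : η ≠ 0) (d : ℕ)
    {β C X : Type*} [Fintype β] [Fintype C] [NormedAddCommGroup X] [NormedSpace ℝ X]
    {b₀ : C → β} {h : C → X →ₗ[ℝ] X} {Ct : (β → X) → C → X} {r₁ δ : ℝ} {Dt : (β → X) → C → X}
    (h17 : Eq17Local ℝ b₀ (fun c => ⇑(h c)) Ct r₁ δ Dt) {b : ℝ} (hb : 0 ≤ b) (hh : ∀ c x, ‖h c x‖ ≤ b * ‖x‖)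
    (e : (β → X) →L[ℝ] (ι → S → 𝔸)) (e' : (ι → S → 𝔸) →L[ℝ] (β → X))
    (Sc : Submodule ℝ (ι → S → 𝔸)) (hS : ∀ v ∈ Sc, ∀ μ x, star (v μ x) = v μ x) {r : ℝ} (hr : 0 < r)
    (hmin : ∀ A ∈ Sc, ‖A‖ < r →
      (actionZ T η d (τ : 𝔸 →ₗ[ℂ] ℂ)
          (prodCfg U η (0 - e (hOp b₀ (fun c => ⇑(h c)) (Dt (e' 0)))))).re
        ≤ (actionZ T η d (τ : 𝔸 →ₗ[ℂ] ℂ)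
          (prodCfg U η (A - e (hOp b₀ (fun c => ⇑(h c)) (Dt (e' A)))))).re) :
    ∀ v ∈ Sc, bondPair η d (τ : 𝔸 →ₗ[ℂ] ℂ) v (J T U η) = 0 := by
  -- `D̃(0) = 0`
  have hD0 : (fun A : ι → S → 𝔸 => e (hOp b₀ (fun c => ⇑(h c)) (Dt (e' A)))) 0 = 0 := by
    simp only [map_zero, hOp_Dt_zero h17]
  -- `D̃′(0) = 0` by the chain rule around `fderiv_hOp_Dt_zero`
  have hD : HasFDerivAt (fun A : β → X => hOp b₀ (fun c => ⇑(h c)) (Dt A))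
      (0 : (β → X) →L[ℝ] (β → X)) (e' 0) := by
    rw [map_zero]; exact fderiv_hOp_Dt_zero h17 hb hh
  have h1 : HasFDerivAt (fun A : ι → S → 𝔸 => hOp b₀ (fun c => ⇑(h c)) (Dt (e' A)))
      (0 : (ι → S → 𝔸) →L[ℝ] (β → X)) 0 :=
    (hD.comp (0 : ι → S → 𝔸) e'.hasFDerivAt).congr_fderiv (by simp)
  have h2 : HasFDerivAt (fun A : ι → S → 𝔸 => e (hOp b₀ (fun c => ⇑(h c)) (Dt (e' A))))
      (0 : (ι → S → 𝔸) →L[ℝ] (ι → S → 𝔸)) 0 :=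
    (e.hasFDerivAt.comp (0 : ι → S → 𝔸) h1).congr_fderiv (by simp)
  exact inner_J_eq_zero_b11_zpow T U hU τ hτ hτs η hη d hD0 h2 Sc hS hr hmin

end Hermitian

end B11CarrierZ

-- Axiom audit (scratch, not shipped): `#print axioms` of `linearTerm_vanishes`, `inner_J_eq_zero_of_eq17Local`,
-- `fderiv_comp_subtype_eq_zero`, `linear_term_absent_19` = [propext, Classical.choice, Quot.sound]; non-vacuity
-- `example`s (scratch): `f(x) = x²` on `ℝ` with `S = ⊤`, and `f(x, y) = y` on `ℝ × ℝ` with `S = ker snd` (non-zero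
-- derivative `snd`, conclusion `snd|_S = 0`).

end Literature.MathematicalPhysics.QuantumFieldTheory.Balaban1983to89.B10Eq19LinearTerm
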